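import Mathlib.Order.Preorder.Finite
import Mathlib.Order.WellQuasiOrder
import Mathlib.Order.UpperLower.Basic
import Mathlib.Algebra.Group.Pointwise.Set.Basic
import Mathlib.Algebra.Order.Monoid.Prod
import Mathlib.Algebra.Order.Group.Basic
import Mathlib.NumberTheory.FrobeniusNumber
import Literature.NumberTheory.ConnesConsani.FrobeniusCompositionGerms
import HarnessLib

/-!
# Connes–Consani, *Geometry of the arithmetic site* (2016), §6.2–6.3 at the semiring level:
# `ℤ_min ⊗_𝔹 ℤ_min = Sub(ℤ × ℤ)` (Lemma 6.2, Def. 6.3, Lemmas 6.4–6.5, Props. 6.6–6.7), the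
# product `μ`, the Frobenius endomorphisms `Fr_{n,m}` (Prop. 6.12) and `ℱ(λ,q)` on
# `ℤ_min ⊗_𝔹 ℤ_min` (Prop. 6.13 (i)–(ii), eq. (57)) — PROVED

Topic `Literature/NumberTheory/ConnesConsani`. Source: A. Connes, C. Consani, *Geometry of the
arithmetic site*, Adv. Math. 291 (2016) 274–329 = arXiv:1502.05580 [bib
`ConnesConsani2016ArithmeticSite`], §6 "The square of the arithmetic site and Frobenius
correspondences", §6.2 "The semiring `ℕ̄ ⊗_𝔹 ℕ̄` and the unreduced square", §6.3 "The Frobenius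
correspondences on `𝒜`", and §7.1 (the maps `ι₁, ι₂`, eq. (57)); arXiv pages p0018–p0021. Companion
of `FrobeniusCorrespondence.lean` (gen 4: `ℛ(λ) = ℕλ + ℕ` with `(min,+)`, `ℱ(λ)` on finite subsets
of `ℕ × ℕ`, Prop. 6.13 (iii)) and `FrobeniusComposition.lean` (`ℝ₊^max = 𝕋`, `ℤ_min⁺ = ℕ̄`,
`Fr_u`, `ℛ(λ)` as a sub-semiring, `ℓ(λ)`, `r(λ)`, Def. 7.1). This file types the SQUARE at the
semiring level: the structure semiring `ℤ_min ⊗_𝔹 ℤ_min = Sub(ℤ × ℤ)` of the unreduced square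
(Def. 6.10 takes it as structure sheaf of the topos `ℕ̂^{×2}`; the topos itself is not typed).

## The statements, verbatim (Adv. Math. numbering)

* §6.2: "Let `R` be a `𝔹`-module and consider bilinear maps `φ : ℤ_min × ℤ_min → R`, maps
  fulfilling `φ(a ∧ b, c) = φ(a,c) ⊕ φ(b,c)`, `φ(a, b ∧ c) = φ(a,b) ⊕ φ(a,c)`,
  `φ(∞,b) = φ(a,∞) = 0` where `⊕` denotes the idempotent addition of `R` and `0 ∈ R` the neutral
  element." **Lemma 6.2.** "For any bilinear map `φ : ℤ_min × ℤ_min → R` one has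
  `x₁ ∧ x₂ = x₁, y₁ ∧ y₂ = y₁ ⟹ φ(x₁ ∧ x₂, y₁ ∧ y₂) = φ(x₁,y₁) ⊕ φ(x₂,y₂)`." **Definition 6.3.**
  "Let `J` be a partially ordered set. We denote by `Sub(J)` the set of subsets `E ⊂ J` which are
  finite unions of intervals of the form `I_x := {y ∣ y ≥ x}`." **Lemma 6.4.** "`Sub(J)` endowed with
  the operation `E ⊕ E' := E ∪ E'` is a `𝔹`-module." **Lemma 6.5.** "Endow `J = ℕ × ℕ` with the
  product ordering […]. Then, `Sub(ℕ × ℕ)` is the set of hereditary subsets of `ℕ × ℕ`."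
  **Proposition 6.6.** "Let `S = Sub(ℤ × ℤ)` […] (i) The following equality defines a bilinear map:
  `ψ : ℤ_min × ℤ_min → S`, `ψ(u,v) = {(a,b) ∈ ℤ × ℤ ∣ a ≥ u, b ≥ v}` (46). (ii) Let `R` be a
  `𝔹`-module and `φ : ℤ_min × ℤ_min → R` be bilinear. Then there exists a unique `𝔹`-linear map
  `ρ : S → R` such that `φ = ρ ∘ ψ`. In other words one has the identification
  `ℤ_min ⊗_𝔹 ℤ_min = Sub(ℤ × ℤ)` (48)." **Proposition 6.7.** "(i) On the `𝔹`-module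
  `S = ℤ_min ⊗_𝔹 ℤ_min` there exists a unique bilinear multiplication satisfying the rule
  `(q^a ⊗_𝔹 q^b)(q^c ⊗_𝔹 q^d) = q^{a+c} ⊗_𝔹 q^{b+d}` (49). (ii) The above multiplication turns
  `S = ℤ_min ⊗_𝔹 ℤ_min` into a semiring of characteristic `1`. (iii) The following equality defines an
  action of `ℕ^× × ℕ^×` by endomorphisms of `ℤ_min ⊗_𝔹 ℤ_min`:
  `Fr_{n,m}(∑ q^a ⊗_𝔹 q^b) := ∑ q^{na} ⊗_𝔹 q^{mb}` (51)." With "`E + E' := {α + α' ∣ α ∈ E, α' ∈ E'}`"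
  (50). **Remark 6.9.** "the diagonal `Fr_{n,n}` […] does not coincide with the operation `x ↦ xⁿ` in
  `ℕ̄ ⊗_𝔹 ℕ̄`. In fact this operation fails to be an endomorphism of `ℕ̄ ⊗_𝔹 ℕ̄` which itself fails
  to be multiplicatively cancellative."
* §6.3: "`μ : (ℤ_min ⊗_𝔹 ℤ_min) → ℤ_min` […] `μ(q^a ⊗_𝔹 q^b) = q^{a+b}` […]
  `μ(∑ q^{n_i} ⊗_𝔹 q^{m_i}) = q^α`, `α = inf(n_i + m_i)` (52)." **Proposition 6.12.** "(i) The range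
  of the composite `μ ∘ Fr_{n,m}(ℤ_min⁺ ⊗_𝔹 ℤ_min⁺) ⊂ ℤ_min⁺` depends, up to canonical isomorphism,
  only upon the ratio `r = n/m`. Assuming `(n,m) = 1`, this range contains the ideal
  `{q^a ∣ a ≥ (n-1)(m-1)} ⊂ ℤ_min⁺`. (ii) The range […] (`(n,m) = 1`) is the semiring `F(n,m)`
  generated by two elements `X, Y` such that `X^m = Y^n` and where the addition comes from a total
  order. If `(n,m) = 1` and `n, m ≠ 1`, the subset `{n,m} ⊂ ℕ` of such pairs is determined by the
  semiring `F(n,m)`. (iii) Let `r = n/m`, `q ∈ (0,1)` and let `m_r : ℤ_min ⊗_𝔹 ℤ_min → ℝ₊^max`,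
  `m_r(∑ q^{n_i} ⊗_𝔹 q^{m_i}) = q^α`, `α = inf(r n_i + m_i)`. Up to canonical isomorphism of their
  ranges, the morphisms `μ ∘ Fr_{n,m}` and `m_r` are equal." (Proof of (i): "by a result of Sylvester
  `x ∈ R_{n,m} ∀ x ≥ (n-1)(m-1)`, `(n-1)(m-1) - 1 ∉ R_{n,m}`"; of (ii): "the elements `X, Y` of `F`
  are the only ones which are indecomposable for the product"; of (iii): eq. (55).)
  **Proposition 6.13 (i)–(ii).** "`ℱ(λ,q) : ℤ_min ⊗_𝔹 ℤ_min → ℝ₊^max`,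
  `ℱ(λ,q)(∑ q^{n_i} ⊗_𝔹 q^{m_i}) = q^α`, `α = inf(λn_i + m_i)` (54) [is a homomorphism of
  semirings]. (ii) The semiring `ℛ(λ) := ℱ(λ,q)(ℤ_min⁺ ⊗_𝔹 ℤ_min⁺)` does not depend, up to
  canonical isomorphism, of the choice of `q ∈ (0,1)`."
* §7.1: "the semiring `ℕ̄ ⊗_𝔹 ℕ̄` is generated by the images `ι_j(ℤ_min⁺)` of the two projections, by
  the morphisms `ι₁(q^n) := q^n ⊗_𝔹 1`, `ι₂(q^n) := 1 ⊗_𝔹 q^n`"; "`ℓ(λ) := ℱ(λ) ∘ ι₁`,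
  `r(λ) := ℱ(λ) ∘ ι₂`" (57). §6.4 (opening): "`(q ⊗_𝔹 1 + 1 ⊗_𝔹 q)² = q² ⊗_𝔹 1 + q ⊗_𝔹 q + 1 ⊗_𝔹 q²
  ≠ q² ⊗_𝔹 1 + 1 ⊗_𝔹 q²` […] By Proposition 4.43 of [Golan], the map `x ↦ xⁿ` is an injective
  endomorphism for any multiplicatively cancellative semiring of characteristic `1`. We thus
  conclude that `ℕ̄ ⊗_𝔹 ℕ̄` fails to be multiplicatively cancellative."

## Rendering

* `ℤ_min = ZMin := Tropical (WithTop ℤ)` (exponent coordinates with `q^∞ = 0`, as `ℤ_min⁺ = ℕ̄` and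
  `ℝ₊^max = 𝕋` in the companion files; `q^n = zexp n`). A `𝔹`-module is an `AddCommMonoid` whose
  addition is idempotent (hypothesis `∀ x, x + x = x` where used); "bilinear" = `IsBBilinear`
  (additive and `∞ ↦ 0` in each variable, verbatim). `Sub(ℤ × ℤ)` = `SubZ2`: a structure carrying
  a subset of `ℤ × ℤ` that is a finite union of quadrants `I_x = Set.Ici x` (Def. 6.3 verbatim),
  with `⊕ = ∪` (Lemma 6.4), product = pointwise sum (50), `0 = ∅`, `1 = ψ(0,0) = I_{(0,0)}`; it is
  a `CommSemiring` (Prop. 6.7 (ii)). The simple tensor `q^a ⊗_𝔹 q^b = ψ(a,b) = I_{(a,b)}` is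
  `quad (a,b)`, `∑_{x∈F} q^{x₁} ⊗ q^{x₂} = ⋃_{x∈F} I_x` is `gen F`; the canonical decomposition of
  Lemma 6.5 (minimal elements) is `minGens`. `ℤ_min⁺ ⊗_𝔹 ℤ_min⁺ = Sub(ℕ × ℕ)` is the
  sub-semiring `subPlus` (`= closure` of the `q^a ⊗ q^b`, `a,b ≥ 0`, `= closure` of
  `ι₁(ℤ_min⁺) ι₂(ℤ_min⁺)`). The universal map `ρ` of Prop. 6.6 (ii) is `lift`/`liftAddHom`
  (`ρ(z) = ∑ φ(β_ℓ)` over the canonical decomposition, the printed well-definedness argument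
  `sum_eq_sum_minGens`), and its multiplicative version `liftRingHom` yields `μ = mu`,
  `Fr_{n,m} = frobNM n m`, `ℱ(λ,q) = frobF λ` as semiring homomorphisms OUT OF `ℤ_min ⊗_𝔹 ℤ_min`
  (the printed domain; gen 4's `frobEval` was `ℱ(λ)` on a finite set of generators —
  `frobF_gen_natCast` is the bridge).
* What is PROVED: **Lemma 6.2** `ConnesConsani2016_lemma_6_2`; **Lemma 6.4 / Prop. 6.7 (ii)** the
  `CommSemiring` instance, `ConnesConsani2016_prop_6_7_ii` (`1 ⊕ 1 = 1`); **Lemma 6.5**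
  `ConnesConsani2016_lemma_6_5` (via Dickson: `ℕ × ℕ` is well-quasi-ordered, Mathlib); **Prop. 6.6
  (i)** `ConnesConsani2016_prop_6_6_i`, **(ii)** `ConnesConsani2016_prop_6_6_ii` (∃! additive `ρ`
  with `φ = ρ ∘ ψ`); **Prop. 6.7 (i)** `ConnesConsani2016_prop_6_7_i` (uniqueness of the bilinear
  multiplication with rule (49); existence = `quad_mul_quad`), **(iii)** `frobNM`, `frobNM_gen`
  (= (51) verbatim), `ConnesConsani2016_prop_6_7_iii` (`Fr_{n,m} ∘ Fr_{n',m'} = Fr_{nn',mm'}`);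
  **eq. (52)** `ConnesConsani2016_eq_52`, **(55)** `ConnesConsani2016_eq_55`; **Prop. 6.12 (i)**
  `ConnesConsani2016_prop_6_12_i` (Sylvester / Mathlib's Chicken-McNugget theorem
  `frobeniusNumber_pair`) with sharpness `…_6_12_i_sharp`; **(ii)** `…_6_12_ii_range` (the range is
  the sub-semiring of `ℤ_min` generated by `X = q^n`, `Y = q^m`, `X^m = Y^n`) and `…_6_12_ii`
  (indecomposables of `R_{n,m} = ℕn + ℕm` are exactly `n, m` for coprime `n, m > 1`); **(iii)**
  `ConnesConsani2016_prop_6_12_iii` (`μ ∘ Fr_{n,m} = Fr_m ∘ ℱ(n/m,q)` into `ℝ₊^max`); **Prop. 6.13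
  (i)** `frobF` + `ConnesConsani2016_prop_6_13_i` (= (54)), **(ii)** `ConnesConsani2016_prop_6_13_ii`
  (`ℱ(λ,q)(ℤ_min⁺ ⊗_𝔹 ℤ_min⁺) = ℛ(λ)` = the companion file's `frobSemiring λ`); **eq. (57)**
  `ConnesConsani2016_eq_57_ell/_r` (`ℓ(λ) = ℱ(λ) ∘ ι₁`, `r(λ) = ℱ(λ) ∘ ι₂` on `ℤ_min⁺`, equal to
  the companion file's `frobEll`/`frobR`); **Remark 6.9 / §6.4** `ConnesConsani2016_sq_not_additive`,
  `ConnesConsani2016_remark_6_9`, `ConnesConsani2016_not_isCancelMulZero` (`ℤ_min ⊗_𝔹 ℤ_min` is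
  not multiplicatively cancellative, by the printed argument through `add_pow_charOne`).
* NOT typed here: §6.1 (the closed monoidal category of `𝔹`-modules in general — only bilinear maps
  out of `ℤ_min × ℤ_min` are used), Def. 6.10 / Prop. 6.11 / Def. 6.22 / Remark 6.23 (the topoi
  `ℕ̂^{×2}` and their points), Remark 6.14 – Prop. 6.16 (best rational approximations), Def. 6.17 –
  Prop. 6.21 (`Conv(ℤ × ℤ)`, the reduced square) and Lemma 7.2 — the latter are the subject of a
  sequel file. The "dependence only on `n/m` up to canonical isomorphism" in 6.12 (i) is (iii).
-/

noncomputable section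

open Set Tropical Pointwise

namespace Literature.NumberTheory.ConnesConsani

local notation "𝕋" => RMaxExp
local notation "ℕ̄" => ZMinPlus

/-! ## `ℤ_min` in exponent coordinates -/

/-- `ℤ_min = (ℤ ∪ {∞}, min, +)`, written multiplicatively as `{q^n : n ∈ ℤ} ∪ {0}` ("we associate
to `n ∈ ℤ_min` the symbol `q^n`"): Mathlib's `Tropical (WithTop ℤ)`.
[cite: ConnesConsani2016ArithmeticSite, §6.2 (after Prop. 6.6: "we shall adopt a multiplicative notation")] -/
abbrev ZMin : Type := Tropical (WithTop ℤ)

/-- The element `q^n ∈ ℤ_min`. [cite: ConnesConsani2016ArithmeticSite, §6.2] -/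
def zexp (n : ℤ) : ZMin := trop (n : WithTop ℤ)

/-- Exponent of `q^n`. [cite: ConnesConsani2016ArithmeticSite, §6.2] -/
@[simp] theorem untrop_zexp (n : ℤ) : untrop (zexp n) = (n : WithTop ℤ) := rfl

/-- `n ↦ q^n` is injective. [cite: ConnesConsani2016ArithmeticSite, §6.2] -/
theorem zexp_injective : Function.Injective zexp := fun a b h => by
  simpa [zexp] using h

/-- `q^n ≠ 0` (`= q^∞`). [cite: ConnesConsani2016ArithmeticSite, §6.2] -/
theorem zexp_ne_zero (n : ℤ) : zexp n ≠ 0 := by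
  intro h; have := congrArg untrop h; simp at this

/-- `q^a q^b = q^{a+b}`. [cite: ConnesConsani2016ArithmeticSite, §6.2 ("The second operation of `ℤ_min` then becomes the ordinary product")] -/
@[simp] theorem zexp_mul (a b : ℤ) : zexp a * zexp b = zexp (a + b) := by
  apply untrop_injective; simp [untrop_mul]

/-- `q^a ∧ q^b = q^{min(a,b)}`. [cite: ConnesConsani2016ArithmeticSite, §6.2 ("the first operation corresponds to the addition in `ℝ₊^max`")] -/
@[simp] theorem zexp_add (a b : ℤ) : zexp a + zexp b = zexp (min a b) := by
  apply untrop_injective; simp only [untrop_add, untrop_zexp]; exact (WithTop.coe_min a b).symm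

/-- `q^0 = 1`. [cite: ConnesConsani2016ArithmeticSite, §6.2] -/
@[simp] theorem zexp_zero : zexp 0 = 1 := by
  apply untrop_injective; simp

/-- Every element of `ℤ_min` is `0 = q^∞` or some `q^n`. [cite: ConnesConsani2016ArithmeticSite, §6.2] -/
theorem eq_zero_or_eq_zexp (x : ZMin) : x = 0 ∨ ∃ n : ℤ, x = zexp n := by
  induction x using Tropical.tropRec with
  | h X =>
    cases X with
    | top => exact Or.inl rfl
    | coe a => exact Or.inr ⟨a, rfl⟩

/-- For `a ≤ b`: `q^a ∧ q^b = q^a`. [cite: ConnesConsani2016ArithmeticSite, Lemma 6.2 (hypothesis `x₁ ∧ x₂ = x₁`)] -/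
theorem zexp_add_of_le {a b : ℤ} (h : a ≤ b) : zexp a + zexp b = zexp a := by
  rw [zexp_add, min_eq_left h]

/-! ## `𝔹`-bilinear maps `ℤ_min × ℤ_min → R` and Lemma 6.2 -/

/-- **Bilinear maps** out of `ℤ_min × ℤ_min` into a `𝔹`-module `R` (an additively written commutative
monoid whose addition `⊕` is idempotent where this matters): "maps fulfilling
`φ(a ∧ b, c) = φ(a,c) ⊕ φ(b,c)`, `φ(a, b ∧ c) = φ(a,b) ⊕ φ(a,c)`, `φ(∞, b) = φ(a, ∞) = 0`".
[cite: ConnesConsani2016ArithmeticSite, §6.2 (before Lemma 6.2)] -/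
structure IsBBilinear {M : Type*} [AddCommMonoid M] (φ : ZMin → ZMin → M) : Prop where
  add_left : ∀ a b c, φ (a + b) c = φ a c + φ b c
  add_right : ∀ a b c, φ a (b + c) = φ a b + φ a c
  zero_left : ∀ b, φ 0 b = 0
  zero_right : ∀ a, φ a 0 = 0

/-- **Connes–Consani 2016, Lemma 6.2**: "For any bilinear map `φ : ℤ_min × ℤ_min → R` one has
`x₁ ∧ x₂ = x₁`, `y₁ ∧ y₂ = y₁ ⟹ φ(x₁ ∧ x₂, y₁ ∧ y₂) = φ(x₁,y₁) ⊕ φ(x₂,y₂)`." Proof as printed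
(associativity of `⊕` and bilinearity). [cite: ConnesConsani2016ArithmeticSite, Lemma 6.2] -/
theorem ConnesConsani2016_lemma_6_2 {M : Type*} [AddCommMonoid M] {φ : ZMin → ZMin → M}
    (hφ : IsBBilinear φ) {x₁ x₂ y₁ y₂ : ZMin} (hx : x₁ + x₂ = x₁) (hy : y₁ + y₂ = y₁) :
    φ (x₁ + x₂) (y₁ + y₂) = φ x₁ y₁ + φ x₂ y₂ :=
  calc φ (x₁ + x₂) (y₁ + y₂) = φ (x₁ + x₂) y₁ := by rw [hy]
  _ = φ x₁ y₁ + φ x₂ y₁ := hφ.add_left _ _ _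
  _ = φ x₁ y₁ + φ x₂ (y₁ + y₂) := by rw [hy]
  _ = φ x₁ y₁ + (φ x₂ y₁ + φ x₂ y₂) := by rw [hφ.add_right]
  _ = (φ x₁ y₁ + φ x₂ y₁) + φ x₂ y₂ := (add_assoc _ _ _).symm
  _ = φ (x₁ + x₂) y₁ + φ x₂ y₂ := by rw [hφ.add_left]
  _ = φ x₁ y₁ + φ x₂ y₂ := by rw [hx]

/-- Lemma 6.2 on exponents: for `(a,b) ≤ (c,d)` the term `φ(q^c, q^d)` is absorbed by `φ(q^a, q^b)`
(the rule (47): "`x₁ ∧ x₂ = x₁, y₁ ∧ y₂ = y₁ ⟹ (x₁ ⊗ y₁) ⊕ (x₂ ⊗ y₂) = x₁ ⊗ y₁`").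
[cite: ConnesConsani2016ArithmeticSite, Lemma 6.2 and eq. (47)] -/
theorem IsBBilinear.absorb {M : Type*} [AddCommMonoid M] {φ : ZMin → ZMin → M} (hφ : IsBBilinear φ)
    {x y : ℤ × ℤ} (h : x ≤ y) :
    φ (zexp x.1) (zexp x.2) + φ (zexp y.1) (zexp y.2) = φ (zexp x.1) (zexp x.2) := by
  rw [← ConnesConsani2016_lemma_6_2 hφ (zexp_add_of_le h.1) (zexp_add_of_le h.2),
    zexp_add_of_le h.1, zexp_add_of_le h.2]

/-! ## Definition 6.3 / Lemmas 6.4–6.5: `Sub(ℤ × ℤ)` -/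

/-- The subsets of `ℤ × ℤ` "which are finite unions of intervals of the form `I_x := {y ∣ y ≥ x}`"
(product ordering). [cite: ConnesConsani2016ArithmeticSite, Def. 6.3] -/
def IsSubZ2 (E : Set (ℤ × ℤ)) : Prop :=
  ∃ F : Finset (ℤ × ℤ), E = ⋃ x ∈ F, Set.Ici x

/-- **Connes–Consani 2016, Definition 6.3: `Sub(ℤ × ℤ)`** — "the set of subsets `E ⊂ J` which are
finite unions of intervals of the form `I_x := {y ∣ y ≥ x}`", for `J = ℤ × ℤ` with the product
ordering; by Prop. 6.6, `ℤ_min ⊗_𝔹 ℤ_min = Sub(ℤ × ℤ)`. [cite: ConnesConsani2016ArithmeticSite, Def. 6.3 and Prop. 6.6 eq. (48)] -/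
structure SubZ2 : Type where
  /-- the hereditary subset `E ⊂ ℤ × ℤ` -/
  carrier : Set (ℤ × ℤ)
  /-- `E` is a finite union of quadrants `I_x` -/
  isSubZ2 : IsSubZ2 carrier

namespace SubZ2

/-- Extensionality: an element of `Sub(ℤ × ℤ)` is a subset of `ℤ × ℤ`. [cite: ConnesConsani2016ArithmeticSite, Def. 6.3] -/
@[ext] theorem ext {E E' : SubZ2} (h : E.carrier = E'.carrier) : E = E' := by
  cases E; cases E'; congr

/-- **`∑_{x ∈ F} q^{x₁} ⊗_𝔹 q^{x₂}`**: the finite union `⋃_{x ∈ F} I_x` ("an element of `S` is a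
finite sum of the form `z = ⊕ ψ(α_i)`"). [cite: ConnesConsani2016ArithmeticSite, Def. 6.3 and Prop. 6.6 (proof of (ii))] -/
def gen (F : Finset (ℤ × ℤ)) : SubZ2 := ⟨⋃ x ∈ F, Set.Ici x, F, rfl⟩

/-- Membership in `⋃_{x ∈ F} I_x`. [cite: ConnesConsani2016ArithmeticSite, Def. 6.3] -/
@[simp] theorem mem_gen {F : Finset (ℤ × ℤ)} {z : ℤ × ℤ} : z ∈ (gen F).carrier ↔ ∃ x ∈ F, x ≤ z := by
  simp [gen]

/-- Every element is some `⋃_{x ∈ F} I_x`. [cite: ConnesConsani2016ArithmeticSite, Def. 6.3] -/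
theorem exists_eq_gen (E : SubZ2) : ∃ F, E = gen F := by
  obtain ⟨F, hF⟩ := E.isSubZ2
  exact ⟨F, ext hF⟩

/-- "Such subsets `E ⊂ J` are hereditary, they fulfill the rule: `x ∈ E ⟹ y ∈ E`, `∀ y ≥ x`."
[cite: ConnesConsani2016ArithmeticSite, Def. 6.3 (remark following it)] -/
theorem isUpperSet (E : SubZ2) : IsUpperSet E.carrier := by
  obtain ⟨F, rfl⟩ := E.exists_eq_gen
  intro y z hyz hy
  obtain ⟨x, hx, hxy⟩ := mem_gen.1 hy
  exact mem_gen.2 ⟨x, hx, hxy.trans hyz⟩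

/-- **The simple tensor `q^a ⊗_𝔹 q^b`** = the quadrant `I_{(a,b)} = ψ(a,b)`.
[cite: ConnesConsani2016ArithmeticSite, Def. 6.3 (`I_x`) and Prop. 6.6 eq. (46)] -/
def quad (x : ℤ × ℤ) : SubZ2 := gen {x}

/-- `I_x` as a set. [cite: ConnesConsani2016ArithmeticSite, Def. 6.3] -/
@[simp] theorem quad_carrier (x : ℤ × ℤ) : (quad x).carrier = Set.Ici x := by
  ext z; simp [quad]

/-- The zero element `∅` ("The empty set `∅ ∈ Sub(J)` is the neutral element for the operation `⊕`").
[cite: ConnesConsani2016ArithmeticSite, Lemma 6.4 (proof)] -/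
instance : Zero SubZ2 := ⟨gen ∅⟩

/-- The unit `ψ(0,0) = ℕ × ℕ` ("`ψ(0,0) = (ℕ × ℕ)` is the neutral element").
[cite: ConnesConsani2016ArithmeticSite, Prop. 6.7 (proof of (i))] -/
instance : One SubZ2 := ⟨quad 0⟩

/-- `0 = ∅`. [cite: ConnesConsani2016ArithmeticSite, Lemma 6.4] -/
@[simp] theorem zero_carrier : (0 : SubZ2).carrier = ∅ := by
  ext z; simp [show (0 : SubZ2) = gen ∅ from rfl]

/-- `1 = I_{(0,0)}`. [cite: ConnesConsani2016ArithmeticSite, Prop. 6.7 (proof of (i))] -/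
@[simp] theorem one_carrier : (1 : SubZ2).carrier = Set.Ici 0 := quad_carrier 0

/-- `Sub(J)` is closed under finite unions. [cite: ConnesConsani2016ArithmeticSite, Lemma 6.4 ("One just needs to check that `E ∪ E' ∈ Sub(J)`")] -/
theorem gen_union (F F' : Finset (ℤ × ℤ)) :
    (gen F).carrier ∪ (gen F').carrier = (gen (F ∪ F')).carrier := by
  ext z
  simp only [Set.mem_union, mem_gen, Finset.mem_union]
  constructor
  · rintro (⟨x, hx, h⟩ | ⟨x, hx, h⟩)
    · exact ⟨x, Or.inl hx, h⟩
    · exact ⟨x, Or.inr hx, h⟩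
  · rintro ⟨x, hx | hx, h⟩
    · exact Or.inl ⟨x, hx, h⟩
    · exact Or.inr ⟨x, hx, h⟩

/-- **Lemma 6.4**: "`Sub(J)` endowed with the operation `E ⊕ E' := E ∪ E'` is a `𝔹`-module" — the
addition of `Sub(ℤ × ℤ)`. [cite: ConnesConsani2016ArithmeticSite, Lemma 6.4] -/
instance : Add SubZ2 :=
  ⟨fun E E' => ⟨E.carrier ∪ E'.carrier, by
    obtain ⟨F, rfl⟩ := E.exists_eq_gen
    obtain ⟨F', rfl⟩ := E'.exists_eq_gen
    rw [gen_union]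
    exact (gen (F ∪ F')).isSubZ2⟩⟩

/-- `E ⊕ E' = E ∪ E'`. [cite: ConnesConsani2016ArithmeticSite, Lemma 6.4] -/
@[simp] theorem add_carrier (E E' : SubZ2) : (E + E').carrier = E.carrier ∪ E'.carrier := rfl

/-- `⊕` of generated elements. [cite: ConnesConsani2016ArithmeticSite, Lemma 6.4] -/
theorem gen_add_gen (F F' : Finset (ℤ × ℤ)) : gen F + gen F' = gen (F ∪ F') :=
  ext (gen_union F F')

/-- `I_x + I_y = I_{x+y}` ("`ψ(u,v) + ψ(u',v') = ψ(u+u', v+v')`"). [cite: ConnesConsani2016ArithmeticSite, Prop. 6.7 (proof of (i))] -/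
theorem Ici_add_Ici (x y : ℤ × ℤ) : Set.Ici x + Set.Ici y = Set.Ici (x + y) := by
  ext z
  rw [Set.mem_add]
  constructor
  · rintro ⟨a, ha, b, hb, rfl⟩
    exact Set.mem_Ici.2 (add_le_add (Set.mem_Ici.1 ha) (Set.mem_Ici.1 hb))
  · intro hz
    exact ⟨x, Set.self_mem_Ici, z - x, Set.mem_Ici.2 (le_sub_iff_add_le'.mpr (Set.mem_Ici.1 hz)),
      by abel⟩

/-- The sum `E + E'` of two finite unions of quadrants is the finite union of the quadrants
`I_{x + x'}`. [cite: ConnesConsani2016ArithmeticSite, Prop. 6.7 eq. (50) ("that `E + E' ∈ Sub(ℤ × ℤ)`")] -/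
theorem gen_sum (F F' : Finset (ℤ × ℤ)) :
    (gen F).carrier + (gen F').carrier = (gen ((F ×ˢ F').image fun p => p.1 + p.2)).carrier := by
  ext z
  simp only [Set.mem_add, mem_gen, Finset.mem_image, Finset.mem_product]
  constructor
  · rintro ⟨a, ⟨x, hx, hxa⟩, b, ⟨y, hy, hyb⟩, rfl⟩
    exact ⟨x + y, ⟨(x, y), ⟨hx, hy⟩, rfl⟩, add_le_add hxa hyb⟩
  · rintro ⟨_, ⟨⟨x, y⟩, ⟨hx, hy⟩, rfl⟩, hle⟩
    exact ⟨x, ⟨x, hx, le_rfl⟩, z - x, ⟨y, hy, le_sub_iff_add_le'.mpr hle⟩, by abel⟩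

/-- **The multiplication of `Sub(ℤ × ℤ)`**: "`E + E' := {α + α' ∣ α ∈ E, α' ∈ E'}`" (eq. (50)).
[cite: ConnesConsani2016ArithmeticSite, Prop. 6.7 eq. (50)] -/
instance : Mul SubZ2 :=
  ⟨fun E E' => ⟨E.carrier + E'.carrier, by
    obtain ⟨F, rfl⟩ := E.exists_eq_gen
    obtain ⟨F', rfl⟩ := E'.exists_eq_gen
    rw [gen_sum]
    exact (gen _).isSubZ2⟩⟩

/-- `E E' = E + E'` as sets. [cite: ConnesConsani2016ArithmeticSite, Prop. 6.7 eq. (50)] -/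
@[simp] theorem mul_carrier (E E' : SubZ2) : (E * E').carrier = E.carrier + E'.carrier := rfl

/-- Product of generated elements ("`(q^a ⊗_𝔹 q^b)(q^c ⊗_𝔹 q^d) = q^{a+c} ⊗_𝔹 q^{b+d}`" summed).
[cite: ConnesConsani2016ArithmeticSite, Prop. 6.7 eq. (49)–(50)] -/
theorem gen_mul_gen (F F' : Finset (ℤ × ℤ)) :
    gen F * gen F' = gen ((F ×ˢ F').image fun p => p.1 + p.2) :=
  ext (gen_sum F F')

/-- `ψ(0,0) + E = E` for hereditary `E`. [cite: ConnesConsani2016ArithmeticSite, Prop. 6.7 (proof of (i): "`ψ(0,0) = (ℕ × ℕ)` is the neutral element")] -/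
theorem Ici_zero_add (E : SubZ2) : Set.Ici (0 : ℤ × ℤ) + E.carrier = E.carrier := by
  ext z
  rw [Set.mem_add]
  constructor
  · rintro ⟨a, ha, b, hb, rfl⟩
    exact E.isUpperSet (le_add_of_nonneg_left (Set.mem_Ici.1 ha)) hb
  · intro hz
    exact ⟨0, Set.self_mem_Ici, z, hz, zero_add z⟩

/-- **Connes–Consani 2016, Prop. 6.7 (ii)**: `Sub(ℤ × ℤ) = ℤ_min ⊗_𝔹 ℤ_min` with `⊕ = ∪` and the
product (50) "is a semiring" (commutative; "The operation (50) is associative and commutative and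
one has `(E ∪ E') + E'' = (E + E'') ∪ (E' + E'')`"). [cite: ConnesConsani2016ArithmeticSite, Prop. 6.7 (ii)] -/
instance : CommSemiring SubZ2 where
  add := (· + ·)
  zero := 0
  mul := (· * ·)
  one := 1
  nsmul := nsmulRec
  npow := npowRec
  nsmul_zero _ := rfl
  nsmul_succ _ _ := rfl
  npow_zero _ := rfl
  npow_succ _ _ := rfl
  add_assoc E E' E'' := ext (Set.union_assoc _ _ _)
  zero_add E := ext (by simp)
  add_zero E := ext (by simp)
  add_comm E E' := ext (Set.union_comm _ _)
  mul_assoc E E' E'' := ext (by simp only [mul_carrier]; exact add_assoc _ _ _)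
  one_mul E := ext (by rw [mul_carrier, one_carrier, Ici_zero_add])
  mul_one E := ext (by rw [mul_carrier, one_carrier, add_comm, Ici_zero_add])
  mul_comm E E' := ext (by simp only [mul_carrier]; exact add_comm _ _)
  zero_mul E := ext (by simp)
  mul_zero E := ext (by simp)
  left_distrib E E' E'' := ext (by simp only [mul_carrier, add_carrier]; exact Set.add_union)
  right_distrib E E' E'' := ext (by simp only [mul_carrier, add_carrier]; exact Set.union_add)

/-- `Sub(ℤ × ℤ)` has characteristic one: `1 ⊕ 1 = 1`. [cite: ConnesConsani2016ArithmeticSite, Prop. 6.7 (ii) ("a semiring of characteristic `1`")] -/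
theorem one_add_one : (1 : SubZ2) + 1 = 1 := ext (Set.union_self _)

/-- `⊕ = ∪` is idempotent. [cite: ConnesConsani2016ArithmeticSite, Lemma 6.4] -/
theorem add_self (E : SubZ2) : E + E = E := ext (Set.union_self _)

/-- `I_x I_y = I_{x+y}`: "`ψ(u,v) + ψ(u',v') = ψ(u+u',v+v')`", i.e.
"`(q^a ⊗_𝔹 q^b)(q^c ⊗_𝔹 q^d) = q^{a+c} ⊗_𝔹 q^{b+d}`" (49). [cite: ConnesConsani2016ArithmeticSite, Prop. 6.7 (i) eq. (49)] -/
theorem quad_mul_quad (x y : ℤ × ℤ) : quad x * quad y = quad (x + y) :=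
  ext (by rw [mul_carrier, quad_carrier, quad_carrier, quad_carrier, Ici_add_Ici])

/-- `I_0 = 1`. [cite: ConnesConsani2016ArithmeticSite, Prop. 6.7 (proof of (i))] -/
theorem quad_zero : quad 0 = 1 := rfl

/-- For `x ≤ y`: `I_x ∪ I_y = I_x` (the rule (47)). [cite: ConnesConsani2016ArithmeticSite, eq. (47)] -/
theorem quad_add_quad_of_le {x y : ℤ × ℤ} (h : x ≤ y) : quad x + quad y = quad x :=
  ext (by
    rw [add_carrier, quad_carrier, quad_carrier]
    exact Set.union_eq_left.2 (Set.Ici_subset_Ici.2 h))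

/-- `⋃_{x∈F} I_x = ∑_{x ∈ F} I_x` in `Sub(ℤ × ℤ)` ("an element of `S` is a finite sum of the form
`z = ⊕ ψ(α_i)`"). [cite: ConnesConsani2016ArithmeticSite, Prop. 6.6 (proof of (ii))] -/
theorem gen_eq_sum (F : Finset (ℤ × ℤ)) : gen F = ∑ x ∈ F, quad x := by
  classical
  induction F using Finset.induction_on with
  | empty => rfl
  | insert a F ha ih =>
    rw [Finset.sum_insert ha, ← ih, show quad a = gen {a} from rfl, gen_add_gen, Finset.insert_eq]

/-! ### The canonical decomposition: minimal elements (Lemma 6.5) -/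

/-- The minimal elements of `E` lie in any generating set. [cite: ConnesConsani2016ArithmeticSite, Lemma 6.5 (proof) and Prop. 6.6 (proof of (ii): "the set of the `α_i`'s necessarily contains as a subset the elements `β_ℓ` of the canonical decomposition")] -/
theorem minimal_mem_of_gen {F : Finset (ℤ × ℤ)} {z : ℤ × ℤ} (hz : Minimal (· ∈ (gen F).carrier) z) :
    z ∈ F := by
  obtain ⟨x, hx, hxz⟩ := mem_gen.1 hz.prop
  have hzx : z ≤ x := hz.le_of_le (mem_gen.2 ⟨x, hx, le_rfl⟩) hxz
  rwa [le_antisymm hzx hxz]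

/-- The set of minimal elements of `E ∈ Sub(ℤ × ℤ)` is finite. [cite: ConnesConsani2016ArithmeticSite, Lemma 6.5 (proof: "finitely many pairs `α_j = (x_j,y_j)`")] -/
theorem finite_minimals (E : SubZ2) : {z | Minimal (· ∈ E.carrier) z}.Finite := by
  obtain ⟨F, rfl⟩ := E.exists_eq_gen
  exact (F.finite_toSet).subset fun z hz => minimal_mem_of_gen hz

/-- **The canonical decomposition** of `E`: its finite set of minimal elements `β_ℓ`
("the elements `β_ℓ` of the canonical decomposition of Lemma 6.5").
[cite: ConnesConsani2016ArithmeticSite, Lemma 6.5 and Prop. 6.6 (proof of (ii))] -/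
def minGens (E : SubZ2) : Finset (ℤ × ℤ) := (finite_minimals E).toFinset

/-- Membership in the canonical decomposition. [cite: ConnesConsani2016ArithmeticSite, Lemma 6.5] -/
@[simp] theorem mem_minGens {E : SubZ2} {z : ℤ × ℤ} : z ∈ E.minGens ↔ Minimal (· ∈ E.carrier) z := by
  simp [minGens]

/-- The canonical generators lie in every generating set. [cite: ConnesConsani2016ArithmeticSite, Prop. 6.6 (proof of (ii))] -/
theorem minGens_subset (F : Finset (ℤ × ℤ)) : (gen F).minGens ⊆ F := fun _ hz =>
  minimal_mem_of_gen (mem_minGens.1 hz)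

/-- Every point of `E` lies above a canonical generator ("for any element `α_j` which is not a
`β_ℓ`, there exists a `β_ℓ` such that `α_j ≥ β_ℓ`"). [cite: ConnesConsani2016ArithmeticSite, Prop. 6.6 (proof of (ii))] -/
theorem exists_minGens_le {E : SubZ2} {z : ℤ × ℤ} (hz : z ∈ E.carrier) : ∃ m ∈ E.minGens, m ≤ z := by
  obtain ⟨F, rfl⟩ := E.exists_eq_gen
  obtain ⟨x, hx, hxz⟩ := mem_gen.1 hz
  obtain ⟨b, hbx, hb⟩ := F.exists_le_minimal hx
  refine ⟨b, mem_minGens.2 ⟨mem_gen.2 ⟨b, hb.prop, le_rfl⟩, fun w hw hwb => ?_⟩, hbx.trans hxz⟩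
  obtain ⟨x', hx', hx'w⟩ := mem_gen.1 hw
  exact (hb.le_of_le hx' (hx'w.trans hwb)).trans hx'w

/-- `E` is generated by its canonical decomposition: `E = ⋃_ℓ I_{β_ℓ}`. [cite: ConnesConsani2016ArithmeticSite, Lemma 6.5 (proof: "`E` is the finite union of the intervals `I_{(x_j,y_j)}`")] -/
theorem gen_minGens (E : SubZ2) : gen E.minGens = E := by
  refine ext (Set.ext fun z => ⟨fun hz => ?_, fun hz => ?_⟩)
  · obtain ⟨m, hm, hmz⟩ := mem_gen.1 hz
    exact E.isUpperSet hmz (mem_minGens.1 hm).prop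
  · obtain ⟨m, hm, hmz⟩ := exists_minGens_le hz
    exact mem_gen.2 ⟨m, hm, hmz⟩

/-- `E = ∑_ℓ I_{β_ℓ}`. [cite: ConnesConsani2016ArithmeticSite, Prop. 6.6 (proof of (ii))] -/
theorem eq_sum_minGens (E : SubZ2) : E = ∑ x ∈ E.minGens, quad x := by
  rw [← gen_eq_sum, gen_minGens]

/-! ### Prop. 6.6 (ii): lifting an absorbing function on `ℤ × ℤ` to an additive map on `Sub(ℤ × ℤ)` -/

section Lift

variable {M : Type*} [AddCommMonoid M] (f : ℤ × ℤ → M)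

/-- **The map `ρ`** of Prop. 6.6 (ii): `ρ(z) = ∑ φ(x_i, y_i)` over the canonical decomposition
`z = ⊕ ψ(β_ℓ)`. [cite: ConnesConsani2016ArithmeticSite, Prop. 6.6 (proof of (ii): "`ρ(z) = ∑ φ(x_i,y_i)`")] -/
def lift (E : SubZ2) : M := ∑ x ∈ E.minGens, f x

variable (hM : ∀ x : M, x + x = x) (hf : ∀ x y : ℤ × ℤ, x ≤ y → f x + f y = f x)
include hM hf

/-- **Independence of the decomposition**: "the sum `∑ φ(x_i,y_i)` does not depend on the choice of
the decomposition `z = ⊕ ψ(α_i)`" — it equals the sum over the canonical decomposition, because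
every extra `α_j ≥ β_ℓ` is absorbed (Lemma 6.2). [cite: ConnesConsani2016ArithmeticSite, Prop. 6.6 (proof of (ii))] -/
theorem sum_eq_sum_minGens (F : Finset (ℤ × ℤ)) : ∑ x ∈ F, f x = ∑ x ∈ (gen F).minGens, f x := by
  classical
  refine Finset.sum_eq_of_absorb F f _ ?_ fun x hx => ?_
  · exact Finset.sum_add_sum_of_subset_idem hM (minGens_subset F) f
  · obtain ⟨m, hm, hmx⟩ := exists_minGens_le (E := gen F) (mem_gen.2 ⟨x, hx, le_rfl⟩)
    rw [← Finset.add_sum_idem hM _ f hm, ← add_assoc, add_comm (f x), hf m x hmx]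

/-- `ρ(⊕_{x∈F} ψ(x)) = ∑_{x∈F} φ(x)` for EVERY decomposition. [cite: ConnesConsani2016ArithmeticSite, Prop. 6.6 (proof of (ii))] -/
theorem lift_gen (F : Finset (ℤ × ℤ)) : lift f (gen F) = ∑ x ∈ F, f x :=
  (sum_eq_sum_minGens f hM hf F).symm

omit hM hf in
/-- `ρ(0) = 0`. [cite: ConnesConsani2016ArithmeticSite, Prop. 6.6 (ii)] -/
theorem lift_zero : lift f 0 = 0 := by
  unfold lift
  rw [show (0 : SubZ2).minGens = ∅ from ?_, Finset.sum_empty]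
  ext z
  simp only [mem_minGens, zero_carrier, Finset.notMem_empty, iff_false]
  exact fun h => h.prop

/-- **`ρ` is additive** ("It then follows that `ρ` is additive"). [cite: ConnesConsani2016ArithmeticSite, Prop. 6.6 (proof of (ii))] -/
theorem lift_add (E E' : SubZ2) : lift f (E + E') = lift f E + lift f E' := by
  classical
  conv_lhs => rw [← gen_minGens E, ← gen_minGens E', gen_add_gen, lift_gen f hM hf,
    Finset.sum_union_idem hM]
  rfl

/-- `ρ(ψ(x)) = φ(x)`. [cite: ConnesConsani2016ArithmeticSite, Prop. 6.6 (ii) ("`φ = ρ ∘ ψ`")] -/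
theorem lift_quad (x : ℤ × ℤ) : lift f (quad x) = f x := by
  rw [show quad x = gen {x} from rfl, lift_gen f hM hf, Finset.sum_singleton]

/-- **`ρ : Sub(ℤ × ℤ) → R` as a `𝔹`-linear (additive) map.** [cite: ConnesConsani2016ArithmeticSite, Prop. 6.6 (ii)] -/
def liftAddHom : SubZ2 →+ M where
  toFun := lift f
  map_zero' := lift_zero f
  map_add' := lift_add f hM hf

/-- `liftAddHom` is `lift`. [cite: ConnesConsani2016ArithmeticSite, Prop. 6.6 (ii)] -/
@[simp] theorem liftAddHom_apply (E : SubZ2) : liftAddHom f hM hf E = lift f E := rfl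

end Lift

/-- **Uniqueness in Prop. 6.6 (ii)**: an additive map on `Sub(ℤ × ℤ)` is determined by its values on
the simple tensors `ψ(x) = I_x` ("The uniqueness of `ρ` is implied by `φ = ρ ∘ ψ`").
[cite: ConnesConsani2016ArithmeticSite, Prop. 6.6 (proof of (ii))] -/
theorem addMonoidHom_ext {M : Type*} [AddCommMonoid M] {g g' : SubZ2 →+ M}
    (h : ∀ x, g (quad x) = g' (quad x)) : g = g' := by
  ext E
  rw [eq_sum_minGens E, map_sum, map_sum]
  exact Finset.sum_congr rfl fun x _ => h x

/-- Ring homomorphisms out of `Sub(ℤ × ℤ)` are determined by the simple tensors.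
[cite: ConnesConsani2016ArithmeticSite, Prop. 6.6 (ii) and Prop. 6.7] -/
theorem ringHom_ext {R : Type*} [NonAssocSemiring R] {g g' : SubZ2 →+* R}
    (h : ∀ x, g (quad x) = g' (quad x)) : g = g' :=
  RingHom.coe_addMonoidHom_injective (addMonoidHom_ext h)

/-! ### Multiplicative lifts: homomorphisms of semirings out of `Sub(ℤ × ℤ)` -/

section LiftMul

variable {R : Type*} [CommSemiring R] (f : ℤ × ℤ → R) (hR : ∀ x : R, x + x = x)
  (hf : ∀ x y : ℤ × ℤ, x ≤ y → f x + f y = f x) (hmul : ∀ x y, f (x + y) = f x * f y)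
  (hone : f 0 = 1)
include hR hf hmul

/-- A multiplicative absorbing `f` lifts multiplicatively: `ρ(E E') = ρ(E) ρ(E')`.
[cite: ConnesConsani2016ArithmeticSite, Prop. 6.7 (i) and Prop. 6.13 (proof of (i): "`inf_{E+E'} L_λ = inf_E L_λ + inf_{E'} L_λ`")] -/
theorem lift_mul (E E' : SubZ2) : lift f (E * E') = lift f E * lift f E' := by
  classical
  conv_lhs => rw [← gen_minGens E, ← gen_minGens E', gen_mul_gen, lift_gen f hR hf,
    Finset.sum_image_idem hR, Finset.sum_product' (f := fun x y => f (x + y))]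
  unfold lift
  rw [Finset.sum_mul_sum]
  exact Finset.sum_congr rfl fun x _ => Finset.sum_congr rfl fun y _ => hmul x y

include hone in
/-- **Semiring homomorphisms out of `Sub(ℤ × ℤ) = ℤ_min ⊗_𝔹 ℤ_min`** from a multiplicative,
order-absorbing `f : ℤ × ℤ → R` (the common shape of `μ`, `Fr_{n,m}` and `ℱ(λ,q)`).
[cite: ConnesConsani2016ArithmeticSite, Prop. 6.7 (iii) and Prop. 6.13 (i)] -/
def liftRingHom : SubZ2 →+* R where
  toFun := lift f
  map_zero' := lift_zero f
  map_add' := lift_add f hR hf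
  map_one' := by rw [← quad_zero, lift_quad f hR hf, hone]
  map_mul' := lift_mul f hR hf hmul

include hone in
/-- `liftRingHom` on a simple tensor. [cite: ConnesConsani2016ArithmeticSite, Prop. 6.13 (i)] -/
@[simp] theorem liftRingHom_quad (x : ℤ × ℤ) : liftRingHom f hR hf hmul hone (quad x) = f x :=
  lift_quad f hR hf x

include hone in
/-- `liftRingHom` on any decomposition. [cite: ConnesConsani2016ArithmeticSite, Prop. 6.13 (i)] -/
theorem liftRingHom_gen (F : Finset (ℤ × ℤ)) : liftRingHom f hR hf hmul hone (gen F) = ∑ x ∈ F, f x :=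
  lift_gen f hR hf F

end LiftMul

end SubZ2

open SubZ2

/-! ## Proposition 6.6: `ℤ_min ⊗_𝔹 ℤ_min = Sub(ℤ × ℤ)` -/

/-- **The map `ψ` of Prop. 6.6 (i)**: "`ψ : ℤ_min × ℤ_min → S`, `ψ(u,v) = {(a,b) ∈ ℤ × ℤ ∣ a ≥ u, b ≥ v}`"
(`= I_{(u,v)}` for finite `u, v`, and `∅` if `u` or `v` is `∞`). [cite: ConnesConsani2016ArithmeticSite, Prop. 6.6 (i) eq. (46)] -/
def psi (u v : ZMin) : SubZ2 :=
  WithTop.recTopCoe (C := fun _ => SubZ2) 0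
    (fun a => WithTop.recTopCoe (C := fun _ => SubZ2) 0 (fun b => quad (a, b)) (untrop v)) (untrop u)

/-- `ψ(q^a, q^b) = I_{(a,b)} = q^a ⊗_𝔹 q^b`. [cite: ConnesConsani2016ArithmeticSite, Prop. 6.6 (i) eq. (46)] -/
@[simp] theorem psi_zexp (a b : ℤ) : psi (zexp a) (zexp b) = quad (a, b) := by
  simp [psi, zexp]

/-- `ψ(∞, v) = ∅`. [cite: ConnesConsani2016ArithmeticSite, Prop. 6.6 (i)] -/
@[simp] theorem psi_zero_left (v : ZMin) : psi 0 v = 0 := by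
  simp [psi]

/-- `ψ(u, ∞) = ∅`. [cite: ConnesConsani2016ArithmeticSite, Prop. 6.6 (i)] -/
@[simp] theorem psi_zero_right (u : ZMin) : psi u 0 = 0 := by
  rcases eq_zero_or_eq_zexp u with rfl | ⟨a, rfl⟩ <;> simp [psi, zexp]

/-- **Connes–Consani 2016, Prop. 6.6 (i)**: "The following equality defines a bilinear map:
`ψ : ℤ_min × ℤ_min → S`, `ψ(u,v) = {(a,b) ∈ ℤ × ℤ ∣ a ≥ u, b ≥ v}`." ("For a fixed `v ∈ ℤ`, the map
`u ↦ ψ(u,v)` […] is monotone. This fact gives the required linearity.")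
[cite: ConnesConsani2016ArithmeticSite, Prop. 6.6 (i)] -/
theorem ConnesConsani2016_prop_6_6_i : IsBBilinear psi where
  add_left u u' v := by
    rcases eq_zero_or_eq_zexp u with rfl | ⟨a, rfl⟩
    · simp
    rcases eq_zero_or_eq_zexp u' with rfl | ⟨a', rfl⟩
    · simp
    rcases eq_zero_or_eq_zexp v with rfl | ⟨b, rfl⟩
    · simp
    rw [zexp_add, psi_zexp, psi_zexp, psi_zexp]
    rcases le_total a a' with h | h
    · rw [min_eq_left h, quad_add_quad_of_le (Prod.mk_le_mk.2 ⟨h, le_rfl⟩)]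
    · rw [min_eq_right h, add_comm, quad_add_quad_of_le (Prod.mk_le_mk.2 ⟨h, le_rfl⟩)]
  add_right u v v' := by
    rcases eq_zero_or_eq_zexp u with rfl | ⟨a, rfl⟩
    · simp
    rcases eq_zero_or_eq_zexp v with rfl | ⟨b, rfl⟩
    · simp
    rcases eq_zero_or_eq_zexp v' with rfl | ⟨b', rfl⟩
    · simp
    rw [zexp_add, psi_zexp, psi_zexp, psi_zexp]
    rcases le_total b b' with h | h
    · rw [min_eq_left h, quad_add_quad_of_le (Prod.mk_le_mk.2 ⟨le_rfl, h⟩)]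
    · rw [min_eq_right h, add_comm, quad_add_quad_of_le (Prod.mk_le_mk.2 ⟨le_rfl, h⟩)]
  zero_left v := psi_zero_left v
  zero_right u := psi_zero_right u

/-- **Connes–Consani 2016, Prop. 6.6 (ii)**: "Let `R` be a `𝔹`-module and `φ : ℤ_min × ℤ_min → R` be
bilinear. Then there exists a unique `𝔹`-linear map `ρ : S → R` such that `φ = ρ ∘ ψ`. In other words
one has the identification `ℤ_min ⊗_𝔹 ℤ_min = Sub(ℤ × ℤ)`" (48). Here a `𝔹`-module is an additive
commutative monoid with idempotent addition and `𝔹`-linear = additive.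
[cite: ConnesConsani2016ArithmeticSite, Prop. 6.6 (ii) eq. (48)] -/
theorem ConnesConsani2016_prop_6_6_ii {M : Type*} [AddCommMonoid M] (hM : ∀ x : M, x + x = x)
    (φ : ZMin → ZMin → M) (hφ : IsBBilinear φ) :
    ∃! ρ : SubZ2 →+ M, ∀ u v, ρ (psi u v) = φ u v := by
  set f : ℤ × ℤ → M := fun x => φ (zexp x.1) (zexp x.2) with hfdef
  have hf : ∀ x y : ℤ × ℤ, x ≤ y → f x + f y = f x := fun x y h => hφ.absorb h
  refine ⟨liftAddHom f hM hf, fun u v => ?_, fun ρ' hρ' => addMonoidHom_ext fun x => ?_⟩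
  · rcases eq_zero_or_eq_zexp u with rfl | ⟨a, rfl⟩
    · rw [psi_zero_left, map_zero, hφ.zero_left]
    rcases eq_zero_or_eq_zexp v with rfl | ⟨b, rfl⟩
    · rw [psi_zero_right, map_zero, hφ.zero_right]
    rw [psi_zexp, liftAddHom_apply, lift_quad f hM hf]
  · obtain ⟨a, b⟩ := x
    rw [← psi_zexp, hρ', liftAddHom_apply, psi_zexp, lift_quad f hM hf]

/-! ## Proposition 6.7: the semiring structure and the Frobenius endomorphisms `Fr_{n,m}` -/

/-- **Connes–Consani 2016, Prop. 6.7 (i)**: "On the `𝔹`-module `S = ℤ_min ⊗_𝔹 ℤ_min` there exists a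
unique bilinear multiplication satisfying the rule `(q^a ⊗_𝔹 q^b)(q^c ⊗_𝔹 q^d) = q^{a+c} ⊗_𝔹 q^{b+d}`"
— existence is the product (50) (`quad_mul_quad`); uniqueness: any biadditive operation with this
rule is that product. [cite: ConnesConsani2016ArithmeticSite, Prop. 6.7 (i) eq. (49)] -/
theorem ConnesConsani2016_prop_6_7_i (m : SubZ2 →+ SubZ2 →+ SubZ2)
    (hm : ∀ x y : ℤ × ℤ, m (quad x) (quad y) = quad (x + y)) (E E' : SubZ2) : m E E' = E * E' := by
  have h1 : ∀ x : ℤ × ℤ, m (quad x) = AddMonoidHom.mulLeft (quad x) :=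
    fun x => addMonoidHom_ext fun y => by rw [hm, AddMonoidHom.coe_mulLeft, quad_mul_quad]
  have h2 : m = AddMonoidHom.mul := addMonoidHom_ext fun x => by
    rw [h1]; rfl
  rw [h2]; rfl

/-- **Connes–Consani 2016, Prop. 6.7 (ii)**: "The above multiplication turns `S = ℤ_min ⊗_𝔹 ℤ_min`
into a semiring of characteristic `1`" — the `CommSemiring` structure `SubZ2.instCommSemiring`
together with `1 ⊕ 1 = 1`. [cite: ConnesConsani2016ArithmeticSite, Prop. 6.7 (ii)] -/
theorem ConnesConsani2016_prop_6_7_ii : (1 : SubZ2) + 1 = 1 ∧ ∀ E : SubZ2, E + E = E :=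
  ⟨SubZ2.one_add_one, SubZ2.add_self⟩

/-- The generator map of `Fr_{n,m}`: `q^a ⊗ q^b ↦ q^{na} ⊗ q^{mb}`. [cite: ConnesConsani2016ArithmeticSite, Prop. 6.7 (iii) eq. (51)] -/
def frobPair (n m : ℕ) (x : ℤ × ℤ) : ℤ × ℤ := ((n : ℤ) * x.1, (m : ℤ) * x.2)

/-- `frobPair` is additive. [cite: ConnesConsani2016ArithmeticSite, Prop. 6.7 (iii)] -/
theorem frobPair_add (n m : ℕ) (x y : ℤ × ℤ) : frobPair n m (x + y) = frobPair n m x + frobPair n m y := by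
  simp only [frobPair, Prod.fst_add, Prod.snd_add, Prod.mk_add_mk, mul_add]

/-- `frobPair` is monotone. [cite: ConnesConsani2016ArithmeticSite, Prop. 6.7 (iii)] -/
theorem frobPair_mono (n m : ℕ) {x y : ℤ × ℤ} (h : x ≤ y) : frobPair n m x ≤ frobPair n m y :=
  Prod.mk_le_mk.2 ⟨mul_le_mul_of_nonneg_left h.1 (by positivity),
    mul_le_mul_of_nonneg_left h.2 (by positivity)⟩

/-- **The Frobenius endomorphism `Fr_{n,m}`** of `ℤ_min ⊗_𝔹 ℤ_min`:
"`Fr_{n,m}(∑ q^a ⊗_𝔹 q^b) := ∑ q^{na} ⊗_𝔹 q^{mb}`" (51), a semiring endomorphism.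
[cite: ConnesConsani2016ArithmeticSite, Prop. 6.7 (iii) eq. (51)] -/
def frobNM (n m : ℕ) : SubZ2 →+* SubZ2 :=
  liftRingHom (fun x => quad (frobPair n m x)) SubZ2.add_self
    (fun _ _ h => quad_add_quad_of_le (frobPair_mono n m h))
    (fun x y => by rw [frobPair_add, quad_mul_quad])
    (by rw [show frobPair n m 0 = 0 from by simp [frobPair], quad_zero])

/-- `Fr_{n,m}(q^a ⊗ q^b) = q^{na} ⊗ q^{mb}`. [cite: ConnesConsani2016ArithmeticSite, Prop. 6.7 (iii) eq. (51)] -/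
@[simp] theorem frobNM_quad (n m : ℕ) (x : ℤ × ℤ) : frobNM n m (quad x) = quad (frobPair n m x) :=
  liftRingHom_quad _ _ _ _ _ x

/-- **Connes–Consani 2016, Prop. 6.7 (iii)**, verbatim on sums: "`Fr_{n,m}(∑ q^a ⊗_𝔹 q^b) := ∑ q^{na} ⊗_𝔹 q^{mb}`".
[cite: ConnesConsani2016ArithmeticSite, Prop. 6.7 (iii) eq. (51)] -/
theorem frobNM_gen (n m : ℕ) (F : Finset (ℤ × ℤ)) :
    frobNM n m (gen F) = gen (F.image (frobPair n m)) := by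
  classical
  rw [gen_eq_sum, map_sum, gen_eq_sum, Finset.sum_image_idem SubZ2.add_self]
  exact Finset.sum_congr rfl fun x _ => frobNM_quad n m x

/-- **Prop. 6.7 (iii): "an action of `ℕ^× × ℕ^×` by endomorphisms"** — `Fr_{n,m} ∘ Fr_{n',m'} = Fr_{nn',mm'}`.
[cite: ConnesConsani2016ArithmeticSite, Prop. 6.7 (iii) and eq. (53)] -/
theorem ConnesConsani2016_prop_6_7_iii (n m n' m' : ℕ) :
    (frobNM n m).comp (frobNM n' m') = frobNM (n * n') (m * m') :=
  ringHom_ext fun x => by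
    simp only [RingHom.comp_apply, frobNM_quad, frobPair, Nat.cast_mul]
    congr 1
    ext <;> simp only <;> ring

/-- `Fr_{1,1} = id`. [cite: ConnesConsani2016ArithmeticSite, Prop. 6.7 (iii)] -/
theorem frobNM_one_one : frobNM 1 1 = RingHom.id SubZ2 :=
  ringHom_ext fun x => by simp [frobPair]

/-! ## §6.3: the product `μ`, `ι₁`, `ι₂`, and `ℱ(λ, q)` (Prop. 6.13 (i)–(ii), eq. (57)) -/

/-- Tropical finite sums are minima: `∑_{x∈F} q^{g(x)} = q^{min_F g}` in `ℤ_min`.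
[cite: ConnesConsani2016ArithmeticSite, §6.3 eq. (52) ("since addition in `ℤ_min` corresponds to taking the `inf`")] -/
theorem Finset.sum_zexp {ι : Type*} (F : Finset ι) (hF : F.Nonempty) (g : ι → ℤ) :
    ∑ x ∈ F, zexp (g x) = zexp (F.inf' hF g) := by
  classical
  induction F using Finset.induction_on with
  | empty => exact absurd hF Finset.not_nonempty_empty
  | insert a F ha ih =>
    by_cases hF' : F.Nonempty
    · rw [Finset.sum_insert ha, ih hF', zexp_add, Finset.inf'_insert (H := hF')]
    · obtain rfl := Finset.not_nonempty_iff_eq_empty.1 hF'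
      simp

/-- Tropical finite sums are minima: `∑_{x∈F} q^{g(x)} = q^{min_F g}` in `ℝ₊^max`.
[cite: ConnesConsani2016ArithmeticSite, Prop. 6.13 (i) eq. (54) ("`α = inf (λn_i + m_i)`")] -/
theorem Finset.sum_texp {ι : Type*} (F : Finset ι) (hF : F.Nonempty) (g : ι → ℝ) :
    ∑ x ∈ F, texp (g x) = texp (F.inf' hF g) := by
  classical
  induction F using Finset.induction_on with
  | empty => exact absurd hF Finset.not_nonempty_empty
  | insert a F ha ih =>
    by_cases hF' : F.Nonempty
    · rw [Finset.sum_insert ha, ih hF', texp_add, Finset.inf'_insert (H := hF')]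
    · obtain rfl := Finset.not_nonempty_iff_eq_empty.1 hF'
      simp

/-- **The product `μ : ℤ_min ⊗_𝔹 ℤ_min → ℤ_min`**: "`μ(q^a ⊗_𝔹 q^b) = q^{a+b}`", a morphism of
semirings. [cite: ConnesConsani2016ArithmeticSite, §6.3 (before eq. (52))] -/
def mu : SubZ2 →+* ZMin :=
  liftRingHom (fun x => zexp (x.1 + x.2)) (fun x => by
      rcases eq_zero_or_eq_zexp x with rfl | ⟨n, rfl⟩
      · simp
      · rw [zexp_add, min_self])
    (fun x y h => zexp_add_of_le (add_le_add h.1 h.2))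
    (fun x y => by rw [zexp_mul]; simp only [Prod.fst_add, Prod.snd_add]; congr 1; ring)
    (by simp)

/-- `μ(q^a ⊗ q^b) = q^{a+b}`. [cite: ConnesConsani2016ArithmeticSite, §6.3] -/
@[simp] theorem mu_quad (x : ℤ × ℤ) : mu (quad x) = zexp (x.1 + x.2) :=
  liftRingHom_quad _ _ _ _ _ x

/-- **Eq. (52)**: "`μ(∑ q^{n_i} ⊗_𝔹 q^{m_i}) = q^α`, `α = inf(n_i + m_i)`".
[cite: ConnesConsani2016ArithmeticSite, §6.3 eq. (52)] -/
theorem ConnesConsani2016_eq_52 (F : Finset (ℤ × ℤ)) (hF : F.Nonempty) :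
    mu (gen F) = zexp (F.inf' hF fun x => x.1 + x.2) := by
  rw [mu, liftRingHom_gen, Finset.sum_zexp F hF]

/-- **Eq. (55)**: "`μ ∘ Fr_{n,m}(∑ q^{n_i} ⊗_𝔹 q^{m_i}) = q^α`, `α = inf(n n_i + m m_i)`".
[cite: ConnesConsani2016ArithmeticSite, Prop. 6.12 (proof of (iii)) eq. (55)] -/
theorem ConnesConsani2016_eq_55 (n m : ℕ) (F : Finset (ℤ × ℤ)) (hF : F.Nonempty) :
    mu (frobNM n m (gen F)) = zexp (F.inf' hF fun x => (n : ℤ) * x.1 + (m : ℤ) * x.2) := by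
  classical
  rw [frobNM_gen, ConnesConsani2016_eq_52 _ (hF.image _), Finset.inf'_image]
  rfl

/-- **`ι₁ : ℤ_min → ℤ_min ⊗_𝔹 ℤ_min`**, "`ι₁(q^n) := q^n ⊗_𝔹 1`" (`= ψ(q^n, q^0)`).
[cite: ConnesConsani2016ArithmeticSite, §7.1 ("the morphisms `ι_1(q^n) := q^n ⊗_𝔹 1`, `ι_2(q^n) := 1 ⊗_𝔹 q^n`") and §6.2 (after Def. 6.10: "`q^n ↦ q^n ⊗ 1`")] -/
def iota₁ : ZMin →+* SubZ2 where
  toFun u := psi u (zexp 0)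
  map_zero' := psi_zero_left _
  map_one' := by rw [← zexp_zero, psi_zexp]; rfl
  map_add' u u' := ConnesConsani2016_prop_6_6_i.add_left u u' _
  map_mul' u u' := by
    rcases eq_zero_or_eq_zexp u with rfl | ⟨a, rfl⟩
    · simp
    rcases eq_zero_or_eq_zexp u' with rfl | ⟨a', rfl⟩
    · simp
    rw [zexp_mul, psi_zexp, psi_zexp, psi_zexp, quad_mul_quad, Prod.mk_add_mk, add_zero]

/-- **`ι₂ : ℤ_min → ℤ_min ⊗_𝔹 ℤ_min`**, "`ι₂(q^n) := 1 ⊗_𝔹 q^n`" (`= ψ(q^0, q^n)`).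
[cite: ConnesConsani2016ArithmeticSite, §7.1] -/
def iota₂ : ZMin →+* SubZ2 where
  toFun v := psi (zexp 0) v
  map_zero' := psi_zero_right _
  map_one' := by rw [← zexp_zero, psi_zexp]; rfl
  map_add' v v' := ConnesConsani2016_prop_6_6_i.add_right _ v v'
  map_mul' v v' := by
    rcases eq_zero_or_eq_zexp v with rfl | ⟨b, rfl⟩
    · simp
    rcases eq_zero_or_eq_zexp v' with rfl | ⟨b', rfl⟩
    · simp
    rw [zexp_mul, psi_zexp, psi_zexp, psi_zexp, quad_mul_quad, Prod.mk_add_mk, add_zero]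

/-- `ι₁(q^a) = q^a ⊗ 1 = I_{(a,0)}`. [cite: ConnesConsani2016ArithmeticSite, §7.1] -/
@[simp] theorem iota₁_zexp (a : ℤ) : iota₁ (zexp a) = quad (a, 0) := psi_zexp a 0

/-- `ι₂(q^b) = 1 ⊗ q^b = I_{(0,b)}`. [cite: ConnesConsani2016ArithmeticSite, §7.1] -/
@[simp] theorem iota₂_zexp (b : ℤ) : iota₂ (zexp b) = quad (0, b) := psi_zexp 0 b

/-- `ψ(u,v) = ι₁(u) ι₂(v)`: `q^a ⊗ q^b = (q^a ⊗ 1)(1 ⊗ q^b)`. [cite: ConnesConsani2016ArithmeticSite, §7.1 ("the semiring `ℕ̄ ⊗_𝔹 ℕ̄` is generated by the images `ι_j(ℤ_min⁺)` of the two projections")] -/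
theorem psi_eq_iota_mul (u v : ZMin) : psi u v = iota₁ u * iota₂ v := by
  rcases eq_zero_or_eq_zexp u with rfl | ⟨a, rfl⟩
  · simp
  rcases eq_zero_or_eq_zexp v with rfl | ⟨b, rfl⟩
  · simp
  rw [psi_zexp, iota₁_zexp, iota₂_zexp, quad_mul_quad, Prod.mk_add_mk, add_zero, zero_add]

/-- `μ(ψ(q^a, q^b)) = q^{a+b}`: "the product in the semiring `ℤ_min` as yielding a morphism of semirings
`μ : (ℤ_min ⊗_𝔹 ℤ_min) → ℤ_min`". [cite: ConnesConsani2016ArithmeticSite, §6.3] -/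
theorem mu_psi (u v : ZMin) : mu (psi u v) = u * v := by
  rcases eq_zero_or_eq_zexp u with rfl | ⟨a, rfl⟩
  · simp
  rcases eq_zero_or_eq_zexp v with rfl | ⟨b, rfl⟩
  · simp
  rw [psi_zexp, mu_quad, zexp_mul]

/-- **`ℱ(λ, q) : ℤ_min ⊗_𝔹 ℤ_min → ℝ₊^max`** (`λ ≥ 0`): "`ℱ(λ,q)(∑ q^{n_i} ⊗_𝔹 q^{m_i}) = q^α`,
`α = inf(λn_i + m_i)`", i.e. "`ℱ(λ,q)(E) = q^α`, `α = inf_{x∈E} L_λ(x)`", `L_λ(a,b) := λa + b` — a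
homomorphism of semirings (Prop. 6.13 (i)). In exponent coordinates `ℝ₊^max = 𝕋`, independent of
`q` (Prop. 6.13 (ii)). [cite: ConnesConsani2016ArithmeticSite, Prop. 6.13 (i) eq. (54)] -/
def frobF (l : ℝ) (hl : 0 ≤ l) : SubZ2 →+* 𝕋 :=
  liftRingHom (fun x => texp (l * x.1 + x.2)) (fun x => by
      rcases eq_zero_or_eq_texp x with rfl | ⟨a, rfl⟩
      · simp
      · rw [texp_add, min_self])
    (fun x y h => by
      rw [texp_add, min_eq_left]
      have h1 : (x.1 : ℝ) ≤ y.1 := by exact_mod_cast h.1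
      have h2 : (x.2 : ℝ) ≤ y.2 := by exact_mod_cast h.2
      nlinarith)
    (fun x y => by rw [texp_mul]; simp only [Prod.fst_add, Prod.snd_add]; push_cast; congr 1; ring)
    (by simp)

/-- `ℱ(λ,q)(q^a ⊗ q^b) = q^{λa + b}`. [cite: ConnesConsani2016ArithmeticSite, Prop. 6.13 (i)] -/
@[simp] theorem frobF_quad (l : ℝ) (hl : 0 ≤ l) (x : ℤ × ℤ) :
    frobF l hl (quad x) = texp (l * x.1 + x.2) :=
  liftRingHom_quad _ _ _ _ _ x

/-- **Connes–Consani 2016, Prop. 6.13 (i)**: "`ℱ(λ,q) : ℤ_min ⊗_𝔹 ℤ_min → ℝ₊^max`,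
`ℱ(λ,q)(∑ q^{n_i} ⊗_𝔹 q^{m_i}) = q^α`, `α = inf(λn_i + m_i)`" "defines a homomorphism of semirings"
(the homomorphism is `frobF`; this is its value on sums, eq. (54)).
[cite: ConnesConsani2016ArithmeticSite, Prop. 6.13 (i) eq. (54)] -/
theorem ConnesConsani2016_prop_6_13_i (l : ℝ) (hl : 0 ≤ l) (F : Finset (ℤ × ℤ)) (hF : F.Nonempty) :
    frobF l hl (gen F) = texp (F.inf' hF fun x => l * x.1 + x.2) := by
  rw [frobF, liftRingHom_gen, Finset.sum_texp F hF]

/-- `ℱ(λ)` on a positive decomposition is gen-4's `frobEval` (`inf_{(a,b)∈E}(λa + b)` over `E ⊂ ℕ × ℕ`).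
[cite: ConnesConsani2016ArithmeticSite, Prop. 6.13 (i)] -/
theorem frobF_gen_natCast (l : ℝ) (hl : 0 ≤ l) (E : Finset (ℕ × ℕ)) (hE : E.Nonempty) :
    frobF l hl (gen (E.image fun x => ((x.1 : ℤ), (x.2 : ℤ)))) = texp (frobEval l E hE) := by
  classical
  rw [ConnesConsani2016_prop_6_13_i l hl _ (hE.image _), Finset.inf'_image]
  unfold frobEval
  congr 1
  refine Finset.inf'_congr _ rfl (fun x _ => ?_)
  simp only [Function.comp_apply, Int.cast_natCast]
  ring

/-! ## `ℤ_min⁺ ⊗_𝔹 ℤ_min⁺ = Sub(ℕ × ℕ)` and Prop. 6.13 (ii): `ℛ(λ) = ℱ(λ,q)(ℤ_min⁺ ⊗_𝔹 ℤ_min⁺)` -/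

/-- **`ℤ_min⁺ ⊗_𝔹 ℤ_min⁺ = Sub(ℕ × ℕ)`**: the sub-semiring of `Sub(ℤ × ℤ)` of hereditary subsets of
`ℕ × ℕ` (Lemma 6.5), i.e. of sums `∑ q^{n_i} ⊗_𝔹 q^{m_i}` with `n_i, m_i ∈ ℕ`.
[cite: ConnesConsani2016ArithmeticSite, Lemma 6.5 and §7.1 (`𝒩 := ℤ_min⁺ ⊗_𝔹 ℤ_min⁺`)] -/
def subPlus : Subsemiring SubZ2 where
  carrier := {E | E.carrier ⊆ Set.Ici 0}
  mul_mem' {E E'} hE hE' := by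
    rintro z ⟨a, ha, b, hb, rfl⟩
    exact Set.mem_Ici.2 (add_nonneg (Set.mem_Ici.1 (hE ha)) (Set.mem_Ici.1 (hE' hb)))
  one_mem' := by simp
  add_mem' {E E'} hE hE' := by
    intro z hz
    rcases (Set.mem_union _ _ _).1 hz with h | h
    · exact hE h
    · exact hE' h
  zero_mem' := by simp

/-- Membership in `Sub(ℕ × ℕ)`: the subset lies in the positive quadrant. [cite: ConnesConsani2016ArithmeticSite, Lemma 6.5] -/
theorem mem_subPlus {E : SubZ2} : E ∈ subPlus ↔ E.carrier ⊆ Set.Ici 0 := Iff.rfl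

/-- `q^a ⊗ q^b ∈ ℤ_min⁺ ⊗_𝔹 ℤ_min⁺` for `a, b ≥ 0`. [cite: ConnesConsani2016ArithmeticSite, Lemma 6.5] -/
theorem quad_mem_subPlus {x : ℤ × ℤ} (hx : 0 ≤ x) : quad x ∈ subPlus := by
  rw [mem_subPlus, quad_carrier]
  exact Set.Ici_subset_Ici.2 hx

/-- `E ∈ Sub(ℕ × ℕ)` iff its canonical generators are `≥ 0`. [cite: ConnesConsani2016ArithmeticSite, Lemma 6.5] -/
theorem mem_subPlus_iff_minGens {E : SubZ2} : E ∈ subPlus ↔ ∀ x ∈ E.minGens, 0 ≤ x := by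
  constructor
  · intro h x hx
    exact Set.mem_Ici.1 (h (mem_minGens.1 hx).prop)
  · intro h z hz
    obtain ⟨m, hm, hmz⟩ := exists_minGens_le hz
    exact Set.mem_Ici.2 ((h m hm).trans hmz)

/-- `Sub(ℕ × ℕ)` is generated, as a semiring, by the `q^a ⊗_𝔹 q^b`, `a, b ∈ ℕ` (indeed additively).
[cite: ConnesConsani2016ArithmeticSite, §7.1 ("the semiring `ℕ̄ ⊗_𝔹 ℕ̄` is generated by the images `ι_j(ℤ_min⁺)`")] -/
theorem subPlus_eq_closure : subPlus = Subsemiring.closure {E | ∃ x : ℤ × ℤ, 0 ≤ x ∧ E = quad x} := by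
  refine le_antisymm (fun E hE => ?_) (Subsemiring.closure_le.2 ?_)
  · rw [eq_sum_minGens E]
    exact Subsemiring.sum_mem _ fun x hx =>
      Subsemiring.subset_closure ⟨x, mem_subPlus_iff_minGens.1 hE x hx, rfl⟩
  · rintro _ ⟨x, hx, rfl⟩
    exact quad_mem_subPlus hx

/-- **Connes–Consani 2016, Prop. 6.13 (ii) / §7.1: "`ℛ(λ) := ℱ(λ,q)(ℤ_min⁺ ⊗_𝔹 ℤ_min⁺)`"** —
the image of `Sub(ℕ × ℕ)` under `ℱ(λ,q)` is the sub-semiring `ℛ(λ) = {q^α : α ∈ ℕλ + ℕ} ∪ {0}` of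
`ℝ₊^max` ("does not depend, up to canonical isomorphism, of the choice of `q`": both sides are in
exponent coordinates). [cite: ConnesConsani2016ArithmeticSite, Prop. 6.13 (ii) and §7.1 ("the elements of `ℛ(λ)` are powers `q^α`, where `α ∈ ℕ + λℕ`")] -/
theorem ConnesConsani2016_prop_6_13_ii (l : ℝ) (hl : 0 ≤ l) :
    subPlus.map (frobF l hl) = frobSemiring l := by
  refine le_antisymm ?_ fun x hx => ?_
  · rintro _ ⟨E, hE, rfl⟩
    rw [eq_sum_minGens E, map_sum]
    refine Subsemiring.sum_mem _ fun x hx => ?_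
    have hx0 : 0 ≤ x := mem_subPlus_iff_minGens.1 hE x hx
    rw [frobF_quad]
    have e : l * (x.1 : ℝ) + (x.2 : ℝ) = (x.1.toNat : ℝ) * l + (x.2.toNat : ℝ) := by
      have h1 : ((x.1.toNat : ℤ) : ℝ) = (x.1 : ℝ) := by rw [Int.toNat_of_nonneg hx0.1]
      have h2 : ((x.2.toNat : ℤ) : ℝ) = (x.2 : ℝ) := by rw [Int.toNat_of_nonneg hx0.2]
      push_cast at h1 h2
      rw [← h1, ← h2]; ring
    rw [e]
    exact texp_mem_frobSemiring l _ _
  · rcases eq_zero_or_eq_rElt ⟨x, hx⟩ with h | ⟨n, m, h⟩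
    · have : x = 0 := congrArg Subtype.val h
      subst this
      exact Subsemiring.zero_mem _
    · have hx' : x = texp (n * l + m) := congrArg Subtype.val h
      subst hx'
      refine ⟨quad ((n : ℤ), (m : ℤ)), quad_mem_subPlus (Prod.mk_le_mk.2 ⟨by positivity, by positivity⟩), ?_⟩
      rw [frobF_quad]
      push_cast
      congr 1; ring

/-- The inclusion `ℤ_min⁺ = ℕ̄ ↪ ℤ_min`, `q^n ↦ q^n`. [cite: ConnesConsani2016ArithmeticSite, §6.1 ("`ℤ_min⁺` the sub-semifield")] -/
def plusHomFun (x : ℕ̄) : ZMin := trop ((untrop x).map fun n : ℕ => (n : ℤ))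

/-- `q^n ↦ q^n`. [cite: ConnesConsani2016ArithmeticSite, §6.1] -/
@[simp] theorem plusHomFun_nexp (n : ℕ) : plusHomFun (nexp n) = zexp n := rfl

/-- `0 ↦ 0`. [cite: ConnesConsani2016ArithmeticSite, §6.1] -/
@[simp] theorem plusHomFun_zero : plusHomFun 0 = 0 := rfl

/-- **`ℤ_min⁺ ↪ ℤ_min`** as a semiring homomorphism. [cite: ConnesConsani2016ArithmeticSite, §6.1] -/
def plusHom : ℕ̄ →+* ZMin where
  toFun := plusHomFun
  map_zero' := rfl
  map_one' := by rw [← nexp_zero, plusHomFun_nexp]; simp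
  map_mul' x y := by
    rcases eq_zero_or_eq_nexp x with rfl | ⟨a, rfl⟩ <;>
      rcases eq_zero_or_eq_nexp y with rfl | ⟨b, rfl⟩
    · simp
    · simp
    · simp
    · rw [nexp_mul, plusHomFun_nexp, plusHomFun_nexp, plusHomFun_nexp, zexp_mul]; push_cast; rfl
  map_add' x y := by
    rcases eq_zero_or_eq_nexp x with rfl | ⟨a, rfl⟩ <;>
      rcases eq_zero_or_eq_nexp y with rfl | ⟨b, rfl⟩
    · simp
    · simp
    · simp
    · rw [nexp_add, plusHomFun_nexp, plusHomFun_nexp, plusHomFun_nexp, zexp_add]; push_cast; rfl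

/-- `plusHom (q^n) = q^n`. [cite: ConnesConsani2016ArithmeticSite, §6.1] -/
@[simp] theorem plusHom_nexp (n : ℕ) : plusHom (nexp n) = zexp n := rfl

/-- **Eq. (57), left: "`ℓ(λ) := ℱ(λ) ∘ ι₁`"** — on `ℤ_min⁺`, `ℱ(λ,q)(ι₁(q^n)) = q^{nλ} = ℓ(λ)(q^n)`.
[cite: ConnesConsani2016ArithmeticSite, §7.1 eq. (57)] -/
theorem ConnesConsani2016_eq_57_ell (l : ℝ) (hl : 0 < l) (x : ℕ̄) :
    frobF l hl.le (iota₁ (plusHom x)) = (frobEll l hl x : 𝕋) := by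
  rcases eq_zero_or_eq_nexp x with rfl | ⟨n, rfl⟩
  · simp
  · rw [plusHom_nexp, iota₁_zexp, frobF_quad, coe_frobEll_nexp]
    push_cast
    congr 1; ring

/-- **Eq. (57), right: "`r(λ) := ℱ(λ) ∘ ι₂`"** — on `ℤ_min⁺`, `ℱ(λ,q)(ι₂(q^n)) = q^n = r(λ)(q^n)`.
[cite: ConnesConsani2016ArithmeticSite, §7.1 eq. (57)] -/
theorem ConnesConsani2016_eq_57_r (l : ℝ) (hl : 0 < l) (x : ℕ̄) :
    frobF l hl.le (iota₂ (plusHom x)) = (frobR l x : 𝕋) := by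
  rcases eq_zero_or_eq_nexp x with rfl | ⟨n, rfl⟩
  · simp
  · rw [plusHom_nexp, iota₂_zexp, frobF_quad, coe_frobR_nexp]
    push_cast
    congr 1; ring

/-! ## Proposition 6.12: `μ ∘ Fr_{n,m}` and the Frobenius correspondence of a rational number -/

/-- The inclusion `ℤ_min ↪ ℝ₊^max`, `q^n ↦ q^n` (exponents `ℤ ⊂ ℝ`). [cite: ConnesConsani2016ArithmeticSite, Prop. 6.12 (iii) (ranges of `μ ∘ Fr_{n,m}` in `ℤ_min` vs. `m_r` in `ℝ₊^max`)] -/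
def zminToTFun (x : ZMin) : 𝕋 := trop ((untrop x).map fun n : ℤ => (n : ℝ))

/-- `q^n ↦ q^n`. [cite: ConnesConsani2016ArithmeticSite, Prop. 6.12 (iii)] -/
@[simp] theorem zminToTFun_zexp (n : ℤ) : zminToTFun (zexp n) = texp n := rfl

/-- `0 ↦ 0`. [cite: ConnesConsani2016ArithmeticSite, Prop. 6.12 (iii)] -/
@[simp] theorem zminToTFun_zero : zminToTFun 0 = 0 := rfl

/-- **`ℤ_min ↪ ℝ₊^max`** as a semiring homomorphism. [cite: ConnesConsani2016ArithmeticSite, Prop. 6.12 (iii)] -/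
def zminToT : ZMin →+* 𝕋 where
  toFun := zminToTFun
  map_zero' := rfl
  map_one' := by rw [← zexp_zero, zminToTFun_zexp]; simp
  map_mul' x y := by
    rcases eq_zero_or_eq_zexp x with rfl | ⟨a, rfl⟩ <;>
      rcases eq_zero_or_eq_zexp y with rfl | ⟨b, rfl⟩
    · simp
    · simp
    · simp
    · rw [zexp_mul, zminToTFun_zexp, zminToTFun_zexp, zminToTFun_zexp, texp_mul]; push_cast; rfl
  map_add' x y := by
    rcases eq_zero_or_eq_zexp x with rfl | ⟨a, rfl⟩ <;>
      rcases eq_zero_or_eq_zexp y with rfl | ⟨b, rfl⟩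
    · simp
    · simp
    · simp
    · rw [zexp_add, zminToTFun_zexp, zminToTFun_zexp, zminToTFun_zexp, texp_add]; push_cast; rfl

/-- `zminToT (q^n) = q^n`. [cite: ConnesConsani2016ArithmeticSite, Prop. 6.12 (iii)] -/
@[simp] theorem zminToT_zexp (n : ℤ) : zminToT (zexp n) = texp n := rfl

/-- **Connes–Consani 2016, Prop. 6.12 (iii)**: "Let `r = n/m`, `q ∈ (0,1)` and let
`m_r : ℤ_min ⊗_𝔹 ℤ_min → ℝ₊^max`, `m_r(∑ q^{n_i} ⊗_𝔹 q^{m_i}) = q^α`, `α = inf(r n_i + m_i)`. Up to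
canonical isomorphism of their ranges, the morphisms `μ ∘ Fr_{n,m}` and `m_r` are equal." Precisely
("Since `inf(nn_i + mm_i) = m inf(rn_i + m_i)`"): `μ ∘ Fr_{n,m} = Fr_m ∘ ℱ(n/m, q)` as maps to `ℝ₊^max`,
`Fr_m ∈ Aut(ℝ₊^max)` being the canonical isomorphism and `m_r = ℱ(r,q)`.
[cite: ConnesConsani2016ArithmeticSite, Prop. 6.12 (iii)] -/
theorem ConnesConsani2016_prop_6_12_iii (n m : ℕ) (hm : 0 < m) :
    zminToT.comp (mu.comp (frobNM n m)) =
      (frob m (Nat.cast_nonneg m)).comp (frobF ((n : ℝ) / m) (by positivity)) :=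
  ringHom_ext fun x => by
    simp only [RingHom.comp_apply, frobNM_quad, mu_quad, frobPair, zminToT_zexp, frobF_quad, frob_texp]
    push_cast
    congr 1
    field_simp

/-- `(n-1)(m-1) - 1 = nm - m - n` for `n, m > 1` (Sylvester's Frobenius number).
[cite: ConnesConsani2016ArithmeticSite, Prop. 6.12 (proof of (i): "by a result of Sylvester")] -/
theorem sylvester_number_eq {n m : ℕ} (hn : 1 < n) (hm : 1 < m) : (n - 1) * (m - 1) - 1 = m * n - m - n := by
  have h1 : 1 ≤ (n - 1) * (m - 1) := Nat.one_le_iff_ne_zero.2 (Nat.mul_ne_zero (by omega) (by omega))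
  have h2 : m + n ≤ m * n := Nat.add_le_mul hm hn
  zify [h1, h2, (by omega : m ≤ m * n), (by omega : n ≤ m * n - m), hn.le, hm.le]
  ring

/-- **Connes–Consani 2016, Prop. 6.12 (i)**: "The range of the composite
`μ ∘ Fr_{n,m}(ℤ_min⁺ ⊗_𝔹 ℤ_min⁺) ⊂ ℤ_min⁺` […]. Assuming `(n,m) = 1`, this range contains the ideal
`{q^a ∣ a ≥ (n-1)(m-1)} ⊂ ℤ_min⁺`" ("as for the simplest case of the Frobenius problem […] by a result
of Sylvester `x ∈ R_{n,m} ∀ x ≥ (n-1)(m-1)`"). [cite: ConnesConsani2016ArithmeticSite, Prop. 6.12 (i)] -/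
theorem ConnesConsani2016_prop_6_12_i {n m : ℕ} (hcop : Nat.Coprime n m) {k : ℕ}
    (hk : (n - 1) * (m - 1) ≤ k) : zexp k ∈ subPlus.map (mu.comp (frobNM n m)) := by
  -- `k = na + mb` with `a, b ∈ ℕ`
  obtain ⟨a, b, hab⟩ : ∃ a b : ℕ, n * a + m * b = k := by
    rcases Nat.lt_or_ge 1 n with hn | hn
    · rcases Nat.lt_or_ge 1 m with hm | hm
      · have hF := frobeniusNumber_iff.1 (frobeniusNumber_pair hcop.symm hm hn)
        have h1 : 0 < (n - 1) * (m - 1) := Nat.mul_pos (by omega) (by omega)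
        have hk' : m * n - m - n < k := by
          rw [← sylvester_number_eq hn hm]
          exact lt_of_lt_of_le (Nat.sub_lt h1 one_pos) hk
        obtain ⟨b, a, h⟩ := (AddSubmonoid.mem_closure_pair _ _ _).1 (hF.2 k hk')
        exact ⟨a, b, by simp only [smul_eq_mul] at h; linarith⟩
      · -- `m ≤ 1`: `m = 1` (as `(n, m) = 1` and `n > 1` exclude `m = 0`)
        rcases Nat.le_one_iff_eq_zero_or_eq_one.1 hm with rfl | rfl
        · rw [Nat.coprime_zero_right] at hcop; omega
        · exact ⟨0, k, by simp⟩
    · rcases Nat.le_one_iff_eq_zero_or_eq_one.1 hn with rfl | rfl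
      · rw [Nat.coprime_zero_left] at hcop
        subst hcop
        exact ⟨0, k, by simp⟩
      · exact ⟨k, 0, by simp⟩
  refine ⟨quad ((a : ℤ), (b : ℤ)), quad_mem_subPlus (Prod.mk_le_mk.2 ⟨by positivity, by positivity⟩), ?_⟩
  rw [RingHom.comp_apply, frobNM_quad, mu_quad]
  simp only [frobPair]
  rw [← hab]; push_cast; ring_nf

/-- **Prop. 6.12 (i), sharpness**: "`(n-1)(m-1) - 1 ∉ R_{n,m}`" for coprime `n, m > 1` — the Frobenius
number `nm - m - n` is not of the form `na + mb`. [cite: ConnesConsani2016ArithmeticSite, Prop. 6.12 (proof of (i))] -/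
theorem ConnesConsani2016_prop_6_12_i_sharp {n m : ℕ} (hcop : Nat.Coprime n m) (hn : 1 < n) (hm : 1 < m) :
    zexp (((n - 1) * (m - 1) - 1 : ℕ) : ℤ) ∉ subPlus.map (mu.comp (frobNM n m)) := by
  rintro ⟨E, hE, hEq⟩
  rw [RingHom.comp_apply] at hEq
  rcases Finset.eq_empty_or_nonempty E.minGens with h0 | hne
  · have : E = 0 := by rw [eq_sum_minGens E, h0, Finset.sum_empty]
    rw [this, map_zero, map_zero] at hEq
    exact zexp_ne_zero _ hEq.symm
  · rw [← gen_minGens E, ConnesConsani2016_eq_55 n m _ hne] at hEq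
    have hEq' := zexp_injective hEq
    obtain ⟨x, hx, hxeq⟩ := Finset.exists_mem_eq_inf' hne fun x : ℤ × ℤ => (n : ℤ) * x.1 + (m : ℤ) * x.2
    have hx0 : 0 ≤ x := mem_subPlus_iff_minGens.1 hE x hx
    rw [hxeq] at hEq'
    -- `nm - m - n = n a + m b`, contradicting Sylvester
    have hF := (frobeniusNumber_iff.1 (frobeniusNumber_pair hcop.symm hm hn)).1
    apply hF
    rw [AddSubmonoid.mem_closure_pair]
    refine ⟨x.2.toNat, x.1.toNat, ?_⟩
    simp only [smul_eq_mul]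
    rw [← sylvester_number_eq hn hm]
    have h1 : ((x.1.toNat : ℤ)) = x.1 := Int.toNat_of_nonneg hx0.1
    have h2 : ((x.2.toNat : ℤ)) = x.2 := Int.toNat_of_nonneg hx0.2
    zify
    rw [h1, h2, ← hEq']
    ring

/-- `q^k ↦ (q^k)^a` in `ℤ_min`: `(q^k)^a = q^{ak}`. [cite: ConnesConsani2016ArithmeticSite, Prop. 6.12 (proof of (ii): "`ρ(X^aY^b) = q^{na}q^{mb}`")] -/
theorem zexp_pow (k : ℤ) (a : ℕ) : zexp k ^ a = zexp (a * k) := by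
  induction a with
  | zero => simp
  | succ a ih => rw [pow_succ, ih, zexp_mul]; push_cast; ring_nf

/-- **Prop. 6.12 (ii), the range as a semiring**: "The range of `μ ∘ Fr_{n,m}(ℤ_min⁺ ⊗_𝔹 ℤ_min⁺) ⊂ ℤ_min⁺`
[…] is the semiring `F(n,m)` generated by two elements `X, Y` such that `X^m = Y^n` and where the
addition comes from a total order" — here: the range is the sub-semiring of (the totally ordered)
`ℤ_min` generated by `X = q^n` and `Y = q^m` (and `X^m = Y^n = q^{nm}`).
[cite: ConnesConsani2016ArithmeticSite, Prop. 6.12 (ii)] -/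
theorem ConnesConsani2016_prop_6_12_ii_range (n m : ℕ) :
    subPlus.map (mu.comp (frobNM n m)) = Subsemiring.closure {zexp n, zexp m} ∧
      zexp n ^ m = zexp m ^ n := by
  refine ⟨le_antisymm ?_ (Subsemiring.closure_le.2 ?_), by rw [zexp_pow, zexp_pow, mul_comm]⟩
  · rw [subPlus_eq_closure, RingHom.map_closureS]
    refine Subsemiring.closure_le.2 ?_
    rintro _ ⟨_, ⟨x, hx, rfl⟩, rfl⟩
    rw [RingHom.comp_apply, frobNM_quad, mu_quad]
    simp only [frobPair]
    have e : zexp ((n : ℤ) * x.1 + (m : ℤ) * x.2) = zexp n ^ x.1.toNat * zexp m ^ x.2.toNat := by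
      rw [zexp_pow, zexp_pow, zexp_mul, Int.toNat_of_nonneg hx.1, Int.toNat_of_nonneg hx.2]
      congr 1; ring
    rw [e]
    exact mul_mem (pow_mem (Subsemiring.subset_closure (by simp)) _)
      (pow_mem (Subsemiring.subset_closure (by simp)) _)
  · rintro _ (rfl | rfl)
    · refine ⟨quad (1, 0), quad_mem_subPlus (Prod.mk_le_mk.2 ⟨zero_le_one, le_rfl⟩), ?_⟩
      rw [RingHom.comp_apply, frobNM_quad, mu_quad]; simp [frobPair]
    · refine ⟨quad (0, 1), quad_mem_subPlus (Prod.mk_le_mk.2 ⟨le_rfl, zero_le_one⟩), ?_⟩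
      rw [RingHom.comp_apply, frobNM_quad, mu_quad]; simp [frobPair]

/-- Indecomposable elements of an additive subset of `ℕ` (for the exponents `R_{n,m} = {na + mb}` of
the range of `μ ∘ Fr_{n,m}`): `x ≠ 0` in `S`, not a sum of two non-zero elements of `S` ("indecomposable
for the product" for `q^x`). [cite: ConnesConsani2016ArithmeticSite, Prop. 6.12 (proof of (ii))] -/
def IsIndecomposableN (S : Set ℕ) (x : ℕ) : Prop :=
  x ∈ S ∧ x ≠ 0 ∧ ∀ a ∈ S, ∀ b ∈ S, a + b = x → a = 0 ∨ b = 0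

/-- **Connes–Consani 2016, Prop. 6.12 (ii), second sentence**: "If `(n,m) = 1` and `n, m ≠ 1`, the
subset `{n,m} ⊂ ℕ` of such pairs is determined by the semiring `F(n,m)`" — proof as printed: "an
equality of the form `n = na + mb` […] implies that `a = 1` and `b = 0` […]. This shows […] that the
elements `X, Y` of `F` are the only ones which are indecomposable for the product." In exponents: the
indecomposables of `R_{n,m} = ℕn + ℕm` are exactly `n` and `m`.
[cite: ConnesConsani2016ArithmeticSite, Prop. 6.12 (ii)] -/
theorem ConnesConsani2016_prop_6_12_ii {n m : ℕ} (hcop : Nat.Coprime n m) (hn : 1 < n) (hm : 1 < m)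
    (x : ℕ) : IsIndecomposableN (AddSubmonoid.closure {n, m} : Set ℕ) x ↔ x = n ∨ x = m := by
  have hmem : ∀ y, y ∈ (AddSubmonoid.closure {n, m} : Set ℕ) ↔ ∃ a b : ℕ, a * n + b * m = y := fun y => by
    rw [SetLike.mem_coe, AddSubmonoid.mem_closure_pair]; simp only [smul_eq_mul]
  have hnm : ¬ m ∣ n := fun h => by
    have := Nat.Coprime.eq_one_of_dvd (hcop.symm) h; omega
  have hmn : ¬ n ∣ m := fun h => by
    have := Nat.Coprime.eq_one_of_dvd hcop h; omega
  constructor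
  · rintro ⟨hx, hx0, hind⟩
    obtain ⟨a, b, rfl⟩ := (hmem _).1 hx
    -- split off one generator unless `(a,b) ∈ {(1,0),(0,1)}`
    rcases Nat.lt_or_ge 0 a with ha | ha
    · -- `a ≥ 1`: `x = n + ((a-1)n + bm)`
      have h := hind n ((hmem n).2 ⟨1, 0, by ring⟩) ((a - 1) * n + b * m)
        ((hmem _).2 ⟨a - 1, b, rfl⟩) (by
          have : a = (a - 1) + 1 := by omega
          conv_rhs => rw [this]
          ring)
      rcases h with h | h
      · omega
      · left
        have hb : b * m = 0 := by omega
        have ha1 : (a - 1) * n = 0 := by omega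
        rcases Nat.mul_eq_zero.1 ha1 with h1 | h1
        · have : a = 1 := by omega
          subst this; simp [hb]
        · omega
    · -- `a = 0`: `x = bm`, `b ≥ 1`
      have ha0 : a = 0 := by omega
      subst ha0
      rcases Nat.lt_or_ge 0 b with hb | hb
      · have h := hind m ((hmem m).2 ⟨0, 1, by ring⟩) ((b - 1) * m) ((hmem _).2 ⟨0, b - 1, by ring⟩)
          (by
            have : b = (b - 1) + 1 := by omega
            conv_rhs => rw [this]
            ring)
        rcases h with h | h
        · omega
        · right
          rcases Nat.mul_eq_zero.1 h with h1 | h1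
          · have : b = 1 := by omega
            subst this; simp
          · omega
      · exfalso; apply hx0; have : b = 0 := by omega
        subst this; simp
  · rintro (rfl | rfl)
    · refine ⟨(hmem _).2 ⟨1, 0, by ring⟩, by omega, fun s hs t ht hst => ?_⟩
      obtain ⟨a, b, rfl⟩ := (hmem s).1 hs
      obtain ⟨a', b', rfl⟩ := (hmem t).1 ht
      -- `x = (a+a')x + (b+b')m`
      by_contra hcon
      push Not at hcon
      obtain ⟨h1, h2⟩ := hcon
      have hA : a + a' ≤ 1 := by nlinarith
      rcases Nat.eq_zero_or_pos (a + a') with h0 | h0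
      · -- `x = (b+b') m`, so `m ∣ x`
        have ha : a = 0 := by omega
        have ha' : a' = 0 := by omega
        subst ha; subst ha'
        exact hnm ⟨b + b', by linarith⟩
      · have h11 : a + a' = 1 := by omega
        have hb : (b + b') * m = 0 := by nlinarith
        rcases Nat.mul_eq_zero.1 hb with hb0 | hb0
        · rcases Nat.eq_zero_or_pos a with rfl | ha
          · have : b = 0 := by omega
            subst this; simp at h1
          · have : a' = 0 := by omega
            subst this
            have : b' = 0 := by omega
            subst this; simp at h2
        · omega
    · refine ⟨(hmem _).2 ⟨0, 1, by ring⟩, by omega, fun s hs t ht hst => ?_⟩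
      obtain ⟨a, b, rfl⟩ := (hmem s).1 hs
      obtain ⟨a', b', rfl⟩ := (hmem t).1 ht
      by_contra hcon
      push Not at hcon
      obtain ⟨h1, h2⟩ := hcon
      have hB : b + b' ≤ 1 := by nlinarith
      rcases Nat.eq_zero_or_pos (b + b') with h0 | h0
      · have hb : b = 0 := by omega
        have hb' : b' = 0 := by omega
        subst hb; subst hb'
        exact hmn ⟨a + a', by linarith⟩
      · have h11 : b + b' = 1 := by omega
        have ha : (a + a') * n = 0 := by nlinarith
        rcases Nat.mul_eq_zero.1 ha with ha0 | ha0
        · rcases Nat.eq_zero_or_pos b with rfl | hb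
          · have : a = 0 := by omega
            subst this; simp at h1
          · have : b' = 0 := by omega
            subst this
            have : a' = 0 := by omega
            subst this; simp at h2
        · omega

/-- `Sub(ℕ × ℕ)` is generated by `ι₁(ℤ_min⁺) ι₂(ℤ_min⁺)`: "the semiring `ℕ̄ ⊗_𝔹 ℕ̄` is generated by the
images `ι_j(ℤ_min⁺)` of the two projections". [cite: ConnesConsani2016ArithmeticSite, §7.1 (before Def. 7.1)] -/
theorem subPlus_eq_closure_iota :
    subPlus = Subsemiring.closure (Set.range (fun x : ℕ̄ => iota₁ (plusHom x)) *
      Set.range (fun x : ℕ̄ => iota₂ (plusHom x))) := by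
  refine le_antisymm ?_ (Subsemiring.closure_le.2 ?_)
  · rw [subPlus_eq_closure]
    refine Subsemiring.closure_mono ?_
    rintro _ ⟨x, hx, rfl⟩
    refine ⟨iota₁ (plusHom (nexp x.1.toNat)), ⟨_, rfl⟩, iota₂ (plusHom (nexp x.2.toNat)), ⟨_, rfl⟩, ?_⟩
    simp only [plusHom_nexp, iota₁_zexp, iota₂_zexp, quad_mul_quad, Prod.mk_add_mk, add_zero, zero_add,
      Int.toNat_of_nonneg hx.1, Int.toNat_of_nonneg hx.2]
  · rintro _ ⟨_, ⟨u, rfl⟩, _, ⟨v, rfl⟩, rfl⟩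
    rcases eq_zero_or_eq_nexp u with rfl | ⟨a, rfl⟩
    · simp
    rcases eq_zero_or_eq_nexp v with rfl | ⟨b, rfl⟩
    · simp
    simp only [plusHom_nexp, iota₁_zexp, iota₂_zexp, quad_mul_quad, Prod.mk_add_mk, add_zero, zero_add]
    exact quad_mem_subPlus (Prod.mk_le_mk.2 ⟨by positivity, by positivity⟩)

/-! ## Lemma 6.5: `Sub(ℕ × ℕ)` is the set of hereditary subsets of `ℕ × ℕ` (Dickson) -/

/-- **Connes–Consani 2016, Lemma 6.5**: "Endow `J = ℕ × ℕ` with the product ordering […]. Then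
`Sub(ℕ × ℕ)` is the set of hereditary subsets of `ℕ × ℕ`." (Every upper set of `ℕ × ℕ` is a finite
union of quadrants; we use that `ℕ × ℕ` is well-quasi-ordered — its antichain of minimal elements is
finite — in place of the printed column-by-column argument.) [cite: ConnesConsani2016ArithmeticSite, Lemma 6.5] -/
theorem ConnesConsani2016_lemma_6_5 (E : Set (ℕ × ℕ)) :
    IsUpperSet E ↔ ∃ F : Finset (ℕ × ℕ), E = ⋃ x ∈ F, Set.Ici x := by
  constructor
  · intro hE
    have hanti : IsAntichain (· ≤ ·) {z | Minimal (· ∈ E) z} :=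
      fun a ha b hb hne hab => hne (le_antisymm hab (hb.le_of_le ha.prop hab))
    have hfin : {z | Minimal (· ∈ E) z}.Finite := WellQuasiOrderedLE.finite_of_isAntichain hanti
    refine ⟨hfin.toFinset, Set.ext fun z => ⟨fun hz => ?_, fun hz => ?_⟩⟩
    · obtain ⟨m, hmz, hm⟩ := exists_minimal_le_of_wellFoundedLT (· ∈ E) z hz
      exact Set.mem_iUnion₂.2 ⟨m, hfin.mem_toFinset.2 hm, hmz⟩
    · obtain ⟨m, hm, hmz⟩ := Set.mem_iUnion₂.1 hz
      exact hE hmz (hfin.mem_toFinset.1 hm).prop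
  · rintro ⟨F, rfl⟩
    exact isUpperSet_iUnion₂ fun x _ => isUpperSet_Ici x

/-! ## §6.4 (opening) and Remark 6.9: `ℤ_min ⊗_𝔹 ℤ_min` is NOT multiplicatively cancellative -/

/-- "`(q ⊗_𝔹 1 + 1 ⊗_𝔹 q)² = q² ⊗_𝔹 1 + q ⊗_𝔹 q + 1 ⊗_𝔹 q² ≠ q² ⊗_𝔹 1 + 1 ⊗_𝔹 q²`" — the map
`x ↦ x²` fails to be additive on `ℕ̄ ⊗_𝔹 ℕ̄`. [cite: ConnesConsani2016ArithmeticSite, §6.4 (before Lemma 6.20)] -/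
theorem ConnesConsani2016_sq_not_additive :
    (quad (1, 0) + quad (0, 1)) ^ 2 ≠ quad (2, 0) + quad (0, 2) := by
  intro h
  have hmem : ((1 : ℤ), (1 : ℤ)) ∈ ((quad (1, 0) + quad (0, 1)) ^ 2).carrier := by
    rw [pow_two, mul_carrier, add_carrier, quad_carrier, quad_carrier, Set.mem_add]
    exact ⟨(1, 0), Or.inl Set.self_mem_Ici, (0, 1), Or.inr Set.self_mem_Ici, rfl⟩
  rw [h, add_carrier, quad_carrier, quad_carrier] at hmem
  rcases hmem with h1 | h1
  · have := (Prod.mk_le_mk.1 (Set.mem_Ici.1 h1)).1; omega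
  · have := (Prod.mk_le_mk.1 (Set.mem_Ici.1 h1)).2; omega

/-- **Remark 6.9 / §6.4**: "the diagonal `Fr_{n,n}` does not coincide with the operation `x ↦ xⁿ` in
`ℕ̄ ⊗_𝔹 ℕ̄`" — `Fr_{2,2}(x) ≠ x²` for `x = q ⊗ 1 + 1 ⊗ q`. [cite: ConnesConsani2016ArithmeticSite, Remark 6.9 and §6.4] -/
theorem ConnesConsani2016_remark_6_9 :
    frobNM 2 2 (quad (1, 0) + quad (0, 1)) ≠ (quad (1, 0) + quad (0, 1)) ^ 2 := by
  rw [map_add, frobNM_quad, frobNM_quad]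
  simp only [frobPair, Nat.cast_ofNat, mul_one, mul_zero]
  exact fun h => ConnesConsani2016_sq_not_additive h.symm

/-- **§6.4: "`ℕ̄ ⊗_𝔹 ℕ̄` fails to be multiplicatively cancellative"** ("By Proposition 4.43 of [Golan],
the map `x ↦ xⁿ` is an injective endomorphism for any multiplicatively cancellative semiring of
characteristic `1`. We thus conclude that `ℕ̄ ⊗_𝔹 ℕ̄` fails to be multiplicatively cancellative") — so
neither is `ℤ_min ⊗_𝔹 ℤ_min = Sub(ℤ × ℤ)`. [cite: ConnesConsani2016ArithmeticSite, §6.4 (before Lemma 6.20) and Remark 6.9] -/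
theorem ConnesConsani2016_not_isCancelMulZero : ¬ IsCancelMulZero SubZ2 := by
  intro hc
  apply ConnesConsani2016_sq_not_additive
  rw [add_pow_charOne SubZ2.one_add_one, pow_two, pow_two, quad_mul_quad, quad_mul_quad]
  rfl

end Literature.NumberTheory.ConnesConsani
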